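import Literature.Geometry.Kaehler.ComplexTorusHodgeLefschetzTriangle
import Literature.Geometry.Kaehler.ComplexTorusSelfIntersectionIndex
import Literature.Geometry.Kaehler.ComplexTorusPoincareDualityHodgeStructure
import Literature.AlgebraicGeometry.HodgeTheory.HodgeStructureIntermediateJacobian
import HarnessLib

/-!
# Theorem 5.4.6 of Lange (Griffiths' intermediate Jacobian): the NS form `E` of `J_G^p(X)`, its
# non-degeneracy and its index `i(p)`, for a polarised complex torus (Steps I–V assembled)

Layer `Literature/Geometry/Kaehler` (+ a short abstract Part A in `Literature/AlgebraicGeometry/HodgeTheory`),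
namespaces `Literature.AlgebraicGeometry.HodgeTheory` (Part A) and `Literature.Geometry.Kaehler.ComplexTorus`
(Part B); lane `lit-hodgefound` (Track 2 foundations library, Layer A). Sequel of
`ComplexTorusHodgeLefschetzTriangle.lean` (Steps II–IV of Thm. 5.4.6 and (5.28)/(5.29) on invariant forms) and of
`HodgeTheory/HodgeStructureIntermediateJacobian.lean` (Prop. 5.4.4: the Griffiths intermediate Jacobian
`J_G^p(H, Λ) = (V_ℝ, J_G)/Λ = V_ℂ/(F^p + Λ)` of a `ℚ`-Hodge structure of weight `2p - 1` as the tree's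
`ComplexTorus (griffithsPeriod H p hp b)`, and Step I of Thm. 5.4.6 for a polarization).

## The source (Lange 2023, §5.4.2, Theorem 5.4.6, after Griffiths 1968)

For a compact Kähler manifold `(M, ω)` of dimension `n` and `p ≤ (n+1)/2`, the alternating form
`E(φ, ψ) = (-1)ᵖ ∫_M ω^{n-2p+1} ∧ φ ∧ ψ` on `H^{2p-1}(M)` ((5.26)) satisfies `E(Λ, Λ) ⊆ ℤ`, and
`H_G^p(φ, ψ) = 2i E(φ, ψ̄)` is a hermitian form on `\overline{F^pH^{2p-1}} ≅ (H^{2p-1}(M, ℝ), J_G)`; the pair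
`(J_G^p(M), H_G^p)` is a NON-DEGENERATE COMPLEX TORUS OF INDEX
`i(p) = Σ_{t=0}^{[(p-2)/2]} Σ_{s=0}^{1+2t} (h^{p-2-2t,p+1-2s+2t} - h^{p-3-2t,p-2s+2t})`. Proof: Step I
(`F^p` isotropic ⟹ `H_G^p ∈ NS(J_G^p)`), Steps II–IV (signs of `H_G^p` on the Hodge–Lefschetz pieces
`Lˢ H_pr^{a,b}` of `\overline{F^p}`: `(-1)^{p-1-a}`), Step V (the pieces are orthogonal, so `H_G^p` is
non-degenerate and its index is the sum of the dimensions of the negative pieces; (5.28), (5.29)).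

## What this file proves (torus level: `M = X = E/Φ(ℤ^ι)` a polarised complex torus, `n = g`)

* Part A (abstract, any splitting `V_ℂ = P ⊕ \overline{P}` / any `ℚ`-Hodge structure of weight `2p - 1`):
  the `ℂ`-linear tangent chart `Splitting.conjChart` / `griffithsChart : ℂ^m → V_ℂ`, `v ↦ a - iJa`, of the
  torus `ComplexTorus (period P hP b)`, injective with range `\overline{P}` (`range_griffithsChart`); NS forms
  from ANY rational alternating `E` with `E_ℂ(P, P) = 0` (`exists_isNSForm_period_of_isotropic`,
  `exists_isNSForm_griffithsPeriod_of_isotropic` — the tree's `exists_isNSForm_griffithsPeriod` is the special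
  case of a polarization, which Lange's `E` is not); the identities `E_ℂ(x, x̄) = 2iE_ℝ(a, Ja)`,
  `ω_{cE}(iv, v) = cE_ℝ(Ja, a)`, `Im 2iE_ℂ(x_w, x̄_v) = 4E_ℝ(a_w, a_v)` on the chart.
* Part B1–B3 (invariant forms of a `g`-dimensional `E` with a non-degenerate real `(1,1)`-form `η`):
  `lowerForms E k c = \overline{F^cH^k} = ⊕_{a<c} Λ^{a,k-a}`; for `k + 1 = 2p ≤ g + 1` its splitting
  `\overline{F^p} = griffithsPos ⊕ griffithsNeg` into the sums of the pieces of cases (a)/(b) of Step IV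
  (`griffithsPos_sup_griffithsNeg`), `H_G^p > 0` on `griffithsPos`, `< 0` on `griffithsNeg`, the two parts
  `H_G^p`-orthogonal (Step V), whence Sylvester's bound `finrank_le_finrank_griffithsNeg`, non-degeneracy
  `exists_griffithsForm_ne_zero`, and the count `finrank_griffithsNeg_eq_griffithsIndex`:
  `dim griffithsNeg = griffithsIndex g p = i(p)` with `h^{r,s} = C(g,r)C(g,s)` ((5.29):
  `finrank_primitiveForms_inf_typeSubmodule`, `dim H_pr^{a,b} = h^{a,b} - h^{a-1,b-1}`).
* Part B4 (the torus `X`, Riemann form `η`, `H^k(X, ℚ) = rationalForms Φ k` with its Hodge structure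
  `hodgeStructure Φ k`, `k = 2p - 1 ≤ g`): Lange's `E = (-1)ᵖ Q_k` as a `ℚ`-bilinear form `griffithsRatForm` on
  `H^k(X, ℚ)` (`Q_k` the Lefschetz intersection form), alternating, with `F^p` isotropic
  (`griffithsRatForm_baseChange_eq_zero`, Step I); the forms chart `griffithsFormsChart = Θ ∘ griffithsChart` of
  `J_G^p(X) = ComplexTorus (griffithsPeriod (hodgeStructure Φ k) p hp b)` with range `lowerForms E k p`;
  `N·H_G^p(σv, σv) = 4ω(iv, v)` and `N·Im H_G^p(σv, σw) = -4ω(v, w)` for the NS form `ω` of `N·E`; and the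
  theorem: **`ω ∈ NS(J_G^p(X))`, `ω` non-degenerate, `hermIndex ω = griffithsIndex g p`**
  (`IsRiemannForm.griffiths_intermediateJacobian_index`, with `hermIndex` the tree's index of a hermitian
  form, Lange §1.6.2), `2 dim J_G^p(X) = C(2g, 2p-1)`, and the numerics of Prop. 5.4.9 (`g = 3`, `p = 2`:
  dimension `10`, index `4`).

Not covered: the range `p > (n+1)/2` (Lange reduces it to `p ≤ (n+1)/2` by Prop. 5.4.5,
`J_G^p ≅ \widehat{J_G^{n-p+1}}`), Remark 5.4.7, Prop. 5.4.8 (`J_G^n(M) ≅ Alb(M)`), the moduli statement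
Thm. 5.4.19. Conventions: `griffithsForm ψ φ = H_G^p(φ, ψ)` is conjugate-linear in the FIRST slot (Mathlib);
the torus' sign convention for `hermIndex` is `H(v, v) = ω(iv, v)` (`ComplexTorusSelfIntersectionIndex`).

## References

* [Lange2023AbelianVarietiesComplex] H. Lange, *Abelian Varieties over the Complex Numbers*, Springer 2023,
  §5.4.2 (5.25)–(5.29), Prop. 5.4.4, Thm. 5.4.6, Prop. 5.4.9; §5.4.1 Lemma 5.4.3; §1.6.2.
* [Griffiths1968PeriodsII] P. Griffiths, Periods of integrals on algebraic manifolds II, Amer. J. Math. 90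
  (1968), §2.
* [VoisinHodgeI2002] C. Voisin, *Hodge Theory and Complex Algebraic Geometry I*, §2.3.1, §7.1.1–7.1.2.
* [GohbergLancasterRodman2005] I. Gohberg, P. Lancaster, L. Rodman, *Indefinite Linear Algebra and
  Applications*, §2.3 Thm. 2.3.2 (Sylvester's law of inertia).
* [vanGeemen1994HodgeAV] B. van Geemen, LNM 1594 (1994), 5.5–5.7.
-/

noncomputable section

set_option maxSynthPendingDepth 3

open scoped TensorProduct
open Module Complex
open Finset.HasAntidiagonal (antidiagonal mem_antidiagonal)
open Literature.Analysis.Complex (IsOfTypeAt typeProjAt typeProjₗ typeProjₗ_apply typeProjAt_add typeSubmodule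
  isOfTypeAt_typeProjAt isOfTypeAt_of_mem_typeSubmodule mem_typeSubmodule_iff sum_antidiagonal_typeProjAt
  iSupIndep_typeSubmodule finrank_typeSubmodule)
open Literature.LinearAlgebra.Alternating (conjForm conj_add conj_zero)
open Literature.AlgebraicGeometry.Motives (IsPosDefOn IsNegDefOn)

/-! ## Part A. The tangent chart `(V_ℝ, J) ≅ \overline{P}` of the torus of a splitting, and NS forms
from alternating forms with isotropic `P` (abstract `ℚ`-Hodge structures) -/

namespace Literature.AlgebraicGeometry.HodgeTheory

open Literature.AlgebraicGeometry.Motives Literature.AlgebraicGeometry.Motives.HodgeStructure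

variable {V : Type*} [AddCommGroup V] [Module ℚ V]

namespace Splitting

variable (P : Submodule ℂ (ℂ ⊗[ℚ] V)) (hP : IsCompl P (complexConj P))

/-- **`(V_ℝ, J) → V_ℂ`, `a ↦ a - iJa`**: the `ℂ`-linear embedding of the complex vector space `(V_ℝ, J)`
of a splitting `V_ℂ = P ⊕ \overline{P}` onto `\overline{P} = {a - iJa}` (Lange:
"`H^{2p-1}(M, ℝ) ≅ H^{2p-1}(M,ℂ)/F^p ≅ \overline{F^p}`"; `J` acts as `+i` on `\overline{P}`).
[cite: Lange2023AbelianVarietiesComplex, §5.4.2 Prop. 5.4.4] -/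
def conjEmb : Literature.Geometry.Kaehler.CxModule (cx P hP) (cx_mul_cx P hP) →ₗ[ℂ] ℂ ⊗[ℚ] V where
  toFun w := mkCx (Literature.Geometry.Kaehler.CxModule.ofCx _ _ w)
    (-cx P hP (Literature.Geometry.Kaehler.CxModule.ofCx _ _ w))
  map_add' w w' := by
    simp only [map_add, neg_add, mkCx_add_mkCx]
  map_smul' z w := by
    simp only [RingHom.id_apply, Literature.Geometry.Kaehler.CxModule.ofCx_smul]
    set a := Literature.Geometry.Kaehler.CxModule.ofCx _ _ w
    refine ext_parts ?_ ?_
    · rw [rePart_mkCx, rePart_smul, rePart_mkCx, imPart_mkCx, smul_neg, sub_neg_eq_add]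
    · rw [imPart_mkCx, imPart_smul, rePart_mkCx, imPart_mkCx]
      simp only [map_add, map_smul, cx_cx, smul_neg, neg_add, neg_neg]

/-- `conjEmb w = a - iJa`, `a = w` read in `V_ℝ`. [cite: Lange2023AbelianVarietiesComplex, §5.4.2 Prop. 5.4.4] -/
theorem conjEmb_apply (w : Literature.Geometry.Kaehler.CxModule (cx P hP) (cx_mul_cx P hP)) :
    conjEmb P hP w = mkCx (Literature.Geometry.Kaehler.CxModule.ofCx _ _ w)
      (-cx P hP (Literature.Geometry.Kaehler.CxModule.ofCx _ _ w)) :=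
  rfl

/-- `a - iJa ∈ \overline{P}`. [cite: Lange2023AbelianVarietiesComplex, §5.4.2 Prop. 5.4.4] -/
theorem conjEmb_mem (w : Literature.Geometry.Kaehler.CxModule (cx P hP) (cx_mul_cx P hP)) :
    conjEmb P hP w ∈ complexConj P := by
  have h := mkCx_neg_mem_complexConj_cxF1 (cx P hP) (cx_cx P hP)
    (Literature.Geometry.Kaehler.CxModule.ofCx _ _ w)
  rwa [cxF1_cx] at h

/-- `a ↦ a - iJa` is injective. [cite: Lange2023AbelianVarietiesComplex, §5.4.2 Prop. 5.4.4] -/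
theorem conjEmb_injective : Function.Injective (conjEmb P hP) :=
  (injective_iff_map_eq_zero _).2 fun _ hw ↦ (mkCx_eq_zero_iff.1 hw).1

/-- **`(V_ℝ, J) ≅ \overline{P}`**: the range of `a ↦ a - iJa` is `\overline{P}` (an element of
`\overline{P}` is `a - iJa` with `a` its real part). [cite: Lange2023AbelianVarietiesComplex, §5.4.2 Prop. 5.4.4] -/
theorem range_conjEmb : LinearMap.range (conjEmb P hP) = complexConj P := by
  refine le_antisymm ?_ fun x hx ↦ ?_
  · rintro _ ⟨w, rfl⟩
    exact conjEmb_mem P hP w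
  · refine ⟨Literature.Geometry.Kaehler.CxModule.toCx _ _ (rePart x), ?_⟩
    rw [conjEmb_apply, Literature.Geometry.Kaehler.CxModule.ofCx_toCx]
    have hx' : x ∈ complexConj (cxF1 (cx P hP)) := by rwa [cxF1_cx]
    exact (eq_mkCx_of_mem_complexConj_cxF1 (cx P hP) hx').symm

variable [Module.Finite ℚ V]

/-- **The tangent chart of the torus of a splitting**: `ℂ^m → V_ℂ`, `m = dim_ℂ P`, the composite of the
inverse complex coordinates `ℂ^m ≅ (V_ℝ, J)` of `ComplexTorus (period P hP b)` with `a ↦ a - iJa`; it is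
`ℂ`-linear, injective, with range `\overline{P}`. [cite: Lange2023AbelianVarietiesComplex, §5.4.2 Prop. 5.4.4] -/
def conjChart : (Fin (finrank ℂ P) → ℂ) →ₗ[ℂ] ℂ ⊗[ℚ] V :=
  conjEmb P hP ∘ₗ
    ((Literature.Geometry.Kaehler.CxModule.cxCoord (cx P hP) (cx_mul_cx P hP) (finrank_real_eq P hP)).symm :
      (Fin (finrank ℂ P) → ℂ) →ₗ[ℂ] Literature.Geometry.Kaehler.CxModule (cx P hP) (cx_mul_cx P hP))

/-- The tangent chart is injective. [cite: Lange2023AbelianVarietiesComplex, §5.4.2 Prop. 5.4.4] -/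
theorem conjChart_injective : Function.Injective (conjChart P hP) :=
  (conjEmb_injective P hP).comp (LinearEquiv.injective _)

/-- The range of the tangent chart is `\overline{P}`. [cite: Lange2023AbelianVarietiesComplex, §5.4.2 Prop. 5.4.4] -/
theorem range_conjChart : LinearMap.range (conjChart P hP) = complexConj P := by
  rw [conjChart, LinearMap.range_comp, LinearEquiv.range, Submodule.map_top, range_conjEmb]

variable {ι : Type*} [Fintype ι] (b : Basis ι ℚ V)

/-- The real vector with lattice coordinates `Ψ⁻¹ v` (`Ψ = period P hP b`) is the vector with complex
coordinates `v`. [cite: Lange2023AbelianVarietiesComplex, §5.4.2 Prop. 5.4.4] -/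
theorem equivFun_symm_period_symm (v : Fin (finrank ℂ P) → ℂ) :
    (b.baseChange ℝ).equivFun.symm ((period P hP b).symm v) =
      Literature.Geometry.Kaehler.CxModule.ofCx _ _
        ((Literature.Geometry.Kaehler.CxModule.cxCoord (cx P hP) (cx_mul_cx P hP)
          (finrank_real_eq P hP)).symm v) := by
  rw [period, Literature.Geometry.Kaehler.CxModule.periodIso_symm_apply, LinearEquiv.symm_apply_apply]
  rfl

/-- **The tangent chart in lattice coordinates**: `conjChart v = a - iJa` with `a = Σ xᵢ (1 ⊗ bᵢ)`,
`x = Ψ⁻¹ v` (`Ψ = period P hP b`). [cite: Lange2023AbelianVarietiesComplex, §5.4.2 Prop. 5.4.4] -/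
theorem conjChart_eq (v : Fin (finrank ℂ P) → ℂ) :
    conjChart P hP v = mkCx ((b.baseChange ℝ).equivFun.symm ((period P hP b).symm v))
      (-cx P hP ((b.baseChange ℝ).equivFun.symm ((period P hP b).symm v))) := by
  rw [equivFun_symm_period_symm]
  rfl

/-- `E_ℂ(x, x̄) = 2i E_ℝ(a, Ja)` for `x = conjChart v = a - iJa` and an alternating `E`.
[cite: vanGeemen1994HodgeAV, 5.6] -/
theorem baseChange_conjChart_conj (E : LinearMap.BilinForm ℚ V) (hE : ∀ x y, E y x = -E x y)
    (v : Fin (finrank ℂ P) → ℂ) :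
    E.baseChange ℂ (conjChart P hP v) (HodgeStructure.conj (conjChart P hP v)) =
      (2 * ((E.baseChange ℝ ((b.baseChange ℝ).equivFun.symm ((period P hP b).symm v))
        (cx P hP ((b.baseChange ℝ).equivFun.symm ((period P hP b).symm v))) : ℝ) : ℂ)) * Complex.I := by
  rw [conjChart_eq P hP b v]
  exact baseChange_mkCx_neg_conj _ E hE _

/-- The translation-invariant `2`-form of `B = c · E_ℝ` (in the coordinates of `1 ⊗ b`) on the torus
`ComplexTorus (period P hP b)`, on the pair `(iv, v)`: `ω_B(iv, v) = c · E_ℝ(Ja, a)`, `a ↔ v`.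
[cite: Lange2023AbelianVarietiesComplex, §5.4.2 Prop. 5.4.4] -/
theorem twoForm_period_I_smul_self (E : LinearMap.BilinForm ℚ V) (B : LinearMap.BilinForm ℝ (ι → ℝ))
    (hB : ∀ x, B x x = 0) {c : ℝ}
    (hBapp : ∀ x y, B x y = c * E.baseChange ℝ ((b.baseChange ℝ).equivFun.symm x)
      ((b.baseChange ℝ).equivFun.symm y)) (v : Fin (finrank ℂ P) → ℂ) :
    Literature.Geometry.Kaehler.ComplexTorus.twoForm (period P hP b) B hB ![Complex.I • v, v] =
      c * E.baseChange ℝ (cx P hP ((b.baseChange ℝ).equivFun.symm ((period P hP b).symm v)))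
        ((b.baseChange ℝ).equivFun.symm ((period P hP b).symm v)) := by
  rw [Literature.Geometry.Kaehler.ComplexTorus.twoForm_apply]
  simp only [Matrix.cons_val_zero, Matrix.cons_val_one]
  rw [Literature.Geometry.Kaehler.ComplexTorus.symm_I_smul, hBapp, equivFun_symm_latticeJ_period]

/-- The `2`-form of `B = c · E_ℝ` on a general pair: `ω_B(v, w) = c · E_ℝ(a_v, a_w)`.
[cite: Lange2023AbelianVarietiesComplex, §5.4.2 Prop. 5.4.4] -/
theorem twoForm_period_apply (E : LinearMap.BilinForm ℚ V) (B : LinearMap.BilinForm ℝ (ι → ℝ))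
    (hB : ∀ x, B x x = 0) {c : ℝ}
    (hBapp : ∀ x y, B x y = c * E.baseChange ℝ ((b.baseChange ℝ).equivFun.symm x)
      ((b.baseChange ℝ).equivFun.symm y)) (v w : Fin (finrank ℂ P) → ℂ) :
    Literature.Geometry.Kaehler.ComplexTorus.twoForm (period P hP b) B hB ![v, w] =
      c * E.baseChange ℝ ((b.baseChange ℝ).equivFun.symm ((period P hP b).symm v))
        ((b.baseChange ℝ).equivFun.symm ((period P hP b).symm w)) := by
  rw [Literature.Geometry.Kaehler.ComplexTorus.twoForm_apply]
  simp only [Matrix.cons_val_zero, Matrix.cons_val_one]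
  rw [hBapp]

variable [DecidableEq ι]

/-- **NS forms on the torus of a splitting from alternating forms with isotropic `P`** (the mechanism of
Thm. 5.4.6 Step I: "`F^p` and `\overline{F^p}` are isotropic for `E` ⟹ `H ∈ NS(J)`"): for a rational
alternating `E` with `E_ℂ(P, P) = 0` and a lattice basis `b`, the translation-invariant `2`-form of
`N · E_ℝ` (`N ≥ 1` clearing the denominators of the `E(bᵢ, bⱼ)`), read on `Λ ⊗ ℝ = ℝ^ι`, is of type
`(1,1)` for the complex structure `J` of the splitting (`E_ℝ(Ja, Jc) = E_ℝ(a, c)`,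
`baseChange_J_J_of_isotropic`) and integral on the lattice: an element of `NS` of the torus
`ComplexTorus (period P hP b)` in the tree's sense `ComplexTorus.IsNSForm`.
[cite: Lange2023AbelianVarietiesComplex, §5.4.2 Thm. 5.4.6 (Step I)] -/
theorem exists_isNSForm_period_of_isotropic (E : LinearMap.BilinForm ℚ V) (hEalt : ∀ x y, E y x = -E x y)
    (hiso : ∀ x ∈ P, ∀ y ∈ P, E.baseChange ℂ x y = 0) :
    ∃ (B : LinearMap.BilinForm ℝ (ι → ℝ)) (hB : ∀ x, B x x = 0) (N : ℕ), 0 < N ∧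
      (∀ x y, B x y = (N : ℝ) * E.baseChange ℝ ((b.baseChange ℝ).equivFun.symm x)
        ((b.baseChange ℝ).equivFun.symm y)) ∧
      Literature.Geometry.Kaehler.ComplexTorus.IsNSForm (period P hP b)
        (Literature.Geometry.Kaehler.ComplexTorus.twoForm (period P hP b) B hB) := by
  obtain ⟨N, hN, hint⟩ := exists_nat_pos_mul_eq_int fun ij : ι × ι => E (b ij.1) (b ij.2)
  set E' : LinearMap.BilinForm ℚ V := (N : ℚ) • E with hE'def
  have hE'alt : ∀ x y, E' y x = -E' x y := fun x y => by
    rw [hE'def, LinearMap.smul_apply, LinearMap.smul_apply, LinearMap.smul_apply,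
      LinearMap.smul_apply, hEalt x y, smul_neg]
  set B : LinearMap.BilinForm ℝ (ι → ℝ) :=
    Literature.Geometry.Kaehler.CxModule.bilinOfBasis (b.baseChange ℝ) (E'.baseChange ℝ) with hBdef
  have hBapp : ∀ x y, B x y = (N : ℝ) * E.baseChange ℝ ((b.baseChange ℝ).equivFun.symm x)
      ((b.baseChange ℝ).equivFun.symm y) := fun x y => by
    rw [hBdef, Literature.Geometry.Kaehler.CxModule.bilinOfBasis_apply, hE'def, baseChange_real_smul,
      Rat.cast_natCast]
  have hBself : ∀ x, B x x = 0 := fun x => by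
    rw [hBdef, Literature.Geometry.Kaehler.CxModule.bilinOfBasis_apply]
    exact baseChange_real_self E' hE'alt _
  have hJJ : ∀ a c, E.baseChange ℝ (cx P hP a) (cx P hP c) = E.baseChange ℝ a c :=
    baseChange_J_J_of_isotropic _ (cx_cx P hP) E fun x hx y hy =>
      hiso x (by rwa [cxF1_cx] at hx) y (by rwa [cxF1_cx] at hy)
  have hBJ : ∀ x y, B (Literature.Geometry.Kaehler.ComplexTorus.latticeJ (period P hP b) x)
      (Literature.Geometry.Kaehler.ComplexTorus.latticeJ (period P hP b) y) = B x y := fun x y => by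
    rw [hBapp, hBapp, equivFun_symm_latticeJ_period, equivFun_symm_latticeJ_period, hJJ]
  have hBint : ∀ i j, ∃ k : ℤ, B (Pi.single i 1) (Pi.single j 1) = k := fun i j => by
    obtain ⟨k, hk⟩ := hint (i, j)
    refine ⟨k, ?_⟩
    rw [hBdef, Literature.Geometry.Kaehler.CxModule.bilinOfBasis_apply,
      Literature.Geometry.Kaehler.CxModule.basis_equivFun_symm_single,
      Literature.Geometry.Kaehler.CxModule.basis_equivFun_symm_single, Module.Basis.baseChange_apply,
      Module.Basis.baseChange_apply, LinearMap.BilinForm.baseChange_tmul, hE'def, LinearMap.smul_apply,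
      LinearMap.smul_apply, smul_eq_mul, hk, mul_one, Rat.smul_one_eq_cast, Rat.cast_intCast]
  refine ⟨B, hBself, N, hN, hBapp, ⟨fun u v => ?_, fun m m' => ?_⟩⟩
  · rw [Literature.Geometry.Kaehler.ComplexTorus.twoForm_apply,
      Literature.Geometry.Kaehler.ComplexTorus.twoForm_apply]
    simp only [Matrix.cons_val_zero, Matrix.cons_val_one]
    rw [Literature.Geometry.Kaehler.ComplexTorus.symm_I_smul, Literature.Geometry.Kaehler.ComplexTorus.symm_I_smul,
      hBJ]
  · have h1 : Literature.Geometry.Kaehler.ComplexTorus.latticeVec (period P hP b) m =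
        period P hP b (Literature.Geometry.Kaehler.ComplexTorus.intVec m) := rfl
    have h2 : Literature.Geometry.Kaehler.ComplexTorus.latticeVec (period P hP b) m' =
        period P hP b (Literature.Geometry.Kaehler.ComplexTorus.intVec m') := rfl
    rw [h1, h2, Literature.Geometry.Kaehler.ComplexTorus.twoForm_apply_apply]
    exact Literature.Geometry.Kaehler.ComplexTorus.exists_int_eq_of_basis B hBint m m'

end Splitting

section Griffiths

variable {n : ℤ} (H : HodgeStructure V n) (p : ℤ) (hp : p + p = n + 1)

/-- **First Riemann relation for `J_G` from an isotropic `F^p`**: `E_ℝ(J_G a, J_G c) = E_ℝ(a, c)` when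
`E_ℂ(F^p, F^p) = 0`. [cite: Lange2023AbelianVarietiesComplex, §5.4.2 Thm. 5.4.6 (Step I)] -/
theorem baseChange_griffithsCx_griffithsCx_of_isotropic (E : LinearMap.BilinForm ℚ V)
    (hiso : ∀ x ∈ H.F p, ∀ y ∈ H.F p, E.baseChange ℂ x y = 0) (a c : ℝ ⊗[ℚ] V) :
    E.baseChange ℝ (griffithsCx H p hp a) (griffithsCx H p hp c) = E.baseChange ℝ a c :=
  baseChange_J_J_of_isotropic _ (griffithsCx_griffithsCx H p hp) E
    (fun x hx y hy => hiso x (by rwa [cxF1_griffithsCx] at hx) y (by rwa [cxF1_griffithsCx] at hy)) a c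

variable [Module.Finite ℚ V]

/-- **The tangent chart of the Griffiths intermediate Jacobian** `J_G^p = (V_ℝ, J_G)/Λ`:
`ℂ^m → V_ℂ`, `m = dim F^p`, `v ↦ a - iJ_G a` (`a` the real vector with complex coordinates `v`), a
`ℂ`-linear isomorphism of the universal cover `ℂ^m` of `ComplexTorus (griffithsPeriod H p hp b)` onto
`\overline{F^p} ⊂ V_ℂ` ("`H^{2p-1}(M,ℝ) ≅ H^{2p-1}(M,ℂ)/F^p ≅ \overline{F^p}`").
[cite: Lange2023AbelianVarietiesComplex, §5.4.2 Prop. 5.4.4] -/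
def griffithsChart : (Fin (finrank ℂ (H.F p)) → ℂ) →ₗ[ℂ] ℂ ⊗[ℚ] V :=
  Splitting.conjChart (H.F p) (H.isCompl_F_complexConj p p hp)

/-- The Griffiths tangent chart is injective. [cite: Lange2023AbelianVarietiesComplex, §5.4.2 Prop. 5.4.4] -/
theorem griffithsChart_injective : Function.Injective (griffithsChart H p hp) :=
  Splitting.conjChart_injective _ _

/-- **The range of the Griffiths tangent chart is `\overline{F^p}`.** [cite: Lange2023AbelianVarietiesComplex, §5.4.2 Prop. 5.4.4] -/
theorem range_griffithsChart : LinearMap.range (griffithsChart H p hp) = complexConj (H.F p) :=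
  Splitting.range_conjChart _ _

variable {ι : Type*} [Fintype ι] (b : Basis ι ℚ V)

/-- **The Griffiths chart in lattice coordinates**: `griffithsChart v = a - iJ_G a`, `a = Σ xᵢ(1 ⊗ bᵢ)`,
`x = Ψ⁻¹v`, `Ψ = griffithsPeriod H p hp b`. [cite: Lange2023AbelianVarietiesComplex, §5.4.2 Prop. 5.4.4] -/
theorem griffithsChart_eq (v : Fin (finrank ℂ (H.F p)) → ℂ) :
    griffithsChart H p hp v = mkCx ((b.baseChange ℝ).equivFun.symm ((griffithsPeriod H p hp b).symm v))
      (-griffithsCx H p hp ((b.baseChange ℝ).equivFun.symm ((griffithsPeriod H p hp b).symm v))) :=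
  Splitting.conjChart_eq _ _ b v

/-- `E_ℂ(x, x̄) = 2i E_ℝ(a, J_G a)` for `x = griffithsChart v = a - iJ_G a`, `E` alternating.
[cite: Lange2023AbelianVarietiesComplex, §5.4.2 Thm. 5.4.6 (Step I)] -/
theorem baseChange_griffithsChart_conj (E : LinearMap.BilinForm ℚ V) (hE : ∀ x y, E y x = -E x y)
    (v : Fin (finrank ℂ (H.F p)) → ℂ) :
    E.baseChange ℂ (griffithsChart H p hp v) (HodgeStructure.conj (griffithsChart H p hp v)) =
      (2 * ((E.baseChange ℝ ((b.baseChange ℝ).equivFun.symm ((griffithsPeriod H p hp b).symm v))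
        (griffithsCx H p hp ((b.baseChange ℝ).equivFun.symm ((griffithsPeriod H p hp b).symm v))) : ℝ) :
          ℂ)) * Complex.I :=
  Splitting.baseChange_conjChart_conj _ _ b E hE v

/-- `ω_B(iv, v) = c · E_ℝ(J_G a, a)` on `J_G^p` for `B = c · E_ℝ` in lattice coordinates.
[cite: Lange2023AbelianVarietiesComplex, §5.4.2 Thm. 5.4.6 (Step I)] -/
theorem twoForm_griffithsPeriod_I_smul_self (E : LinearMap.BilinForm ℚ V)
    (B : LinearMap.BilinForm ℝ (ι → ℝ)) (hB : ∀ x, B x x = 0) {c : ℝ}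
    (hBapp : ∀ x y, B x y = c * E.baseChange ℝ ((b.baseChange ℝ).equivFun.symm x)
      ((b.baseChange ℝ).equivFun.symm y)) (v : Fin (finrank ℂ (H.F p)) → ℂ) :
    Literature.Geometry.Kaehler.ComplexTorus.twoForm (griffithsPeriod H p hp b) B hB ![Complex.I • v, v] =
      c * E.baseChange ℝ (griffithsCx H p hp ((b.baseChange ℝ).equivFun.symm ((griffithsPeriod H p hp b).symm v)))
        ((b.baseChange ℝ).equivFun.symm ((griffithsPeriod H p hp b).symm v)) :=
  Splitting.twoForm_period_I_smul_self _ _ b E B hB hBapp v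

/-- `ω_B(v, w) = c · E_ℝ(a_v, a_w)` on `J_G^p` for `B = c · E_ℝ` in lattice coordinates.
[cite: Lange2023AbelianVarietiesComplex, §5.4.2 Thm. 5.4.6 (Step I)] -/
theorem twoForm_griffithsPeriod_apply (E : LinearMap.BilinForm ℚ V)
    (B : LinearMap.BilinForm ℝ (ι → ℝ)) (hB : ∀ x, B x x = 0) {c : ℝ}
    (hBapp : ∀ x y, B x y = c * E.baseChange ℝ ((b.baseChange ℝ).equivFun.symm x)
      ((b.baseChange ℝ).equivFun.symm y)) (v w : Fin (finrank ℂ (H.F p)) → ℂ) :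
    Literature.Geometry.Kaehler.ComplexTorus.twoForm (griffithsPeriod H p hp b) B hB ![v, w] =
      c * E.baseChange ℝ ((b.baseChange ℝ).equivFun.symm ((griffithsPeriod H p hp b).symm v))
        ((b.baseChange ℝ).equivFun.symm ((griffithsPeriod H p hp b).symm w)) :=
  Splitting.twoForm_period_apply _ _ b E B hB hBapp v w

/-- **`E_ℝ = Im` of `2iE_ℂ(·, \bar ·)` on the Griffiths chart**: for `E` with `F^p` isotropic (so
`E_ℝ(J_G a, J_G c) = E_ℝ(a, c)`), `Im (2i E_ℂ(x_w, x̄_v)) = 4 E_ℝ(a_w, a_v)` where `x = a - iJ_G a`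
(`E_ℂ(a_w - iJa_w, a_v + iJa_v) = 2E_ℝ(a_w, a_v) + i(…)`). [cite: Lange2023AbelianVarietiesComplex, §5.4.2 Thm. 5.4.6 (Step I, (5.26))] -/
theorem im_two_I_mul_baseChange_griffithsChart_conj (E : LinearMap.BilinForm ℚ V)
    (hiso : ∀ x ∈ H.F p, ∀ y ∈ H.F p, E.baseChange ℂ x y = 0) (v w : Fin (finrank ℂ (H.F p)) → ℂ) :
    (2 * Complex.I * E.baseChange ℂ (griffithsChart H p hp w) (HodgeStructure.conj (griffithsChart H p hp v))).im =
      4 * E.baseChange ℝ ((b.baseChange ℝ).equivFun.symm ((griffithsPeriod H p hp b).symm w))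
        ((b.baseChange ℝ).equivFun.symm ((griffithsPeriod H p hp b).symm v)) := by
  rw [griffithsChart_eq H p hp b w, griffithsChart_eq H p hp b v, conj_mkCx, neg_neg, baseChange_mkCx_mkCx, map_neg,
    LinearMap.neg_apply, LinearMap.neg_apply, baseChange_griffithsCx_griffithsCx_of_isotropic H p hp E hiso]
  simp only [Complex.mul_im, Complex.add_im, Complex.add_re, Complex.ofReal_im, Complex.ofReal_re,
    Complex.mul_re, Complex.I_re, Complex.I_im, Complex.re_ofNat, Complex.im_ofNat]
  ring

variable [DecidableEq ι]

/-- **Thm. 5.4.6 Step I for a general alternating `E` with `F^p` isotropic: `E` gives an NS form of the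
Griffiths intermediate Jacobian `J_G^p(H, Λ)`** — the translation-invariant `2`-form of `N · E_ℝ` on
`ComplexTorus (griffithsPeriod H p hp b)` is of type `(1,1)` and integral (the tree's
`exists_isNSForm_griffithsPeriod` is the case `E = ` a polarization of `H`; Lange's `E` of (5.26) is
NOT a polarization of `H^{2p-1}` — its signs alternate along the Lefschetz decomposition — whence this
generalisation). [cite: Lange2023AbelianVarietiesComplex, §5.4.2 Thm. 5.4.6 (Step I)] -/
theorem exists_isNSForm_griffithsPeriod_of_isotropic (E : LinearMap.BilinForm ℚ V)
    (hEalt : ∀ x y, E y x = -E x y) (hiso : ∀ x ∈ H.F p, ∀ y ∈ H.F p, E.baseChange ℂ x y = 0) :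
    ∃ (B : LinearMap.BilinForm ℝ (ι → ℝ)) (hB : ∀ x, B x x = 0) (N : ℕ), 0 < N ∧
      (∀ x y, B x y = (N : ℝ) * E.baseChange ℝ ((b.baseChange ℝ).equivFun.symm x)
        ((b.baseChange ℝ).equivFun.symm y)) ∧
      Literature.Geometry.Kaehler.ComplexTorus.IsNSForm (griffithsPeriod H p hp b)
        (Literature.Geometry.Kaehler.ComplexTorus.twoForm (griffithsPeriod H p hp b) B hB) :=
  Splitting.exists_isNSForm_period_of_isotropic _ _ b E hEalt hiso

end Griffiths

end Literature.AlgebraicGeometry.HodgeTheory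

namespace Literature.Geometry.Kaehler

namespace ComplexTorus

/-! ## Part B1. `\overline{FᵖHᵏ}` on forms and its Hodge–Lefschetz pieces -/

section Lower

variable {E : Type*} [NormedAddCommGroup E] [NormedSpace ℂ E]

variable (E) in
/-- **`\overline{F^c H^k}` on invariant forms**: the sum of the type spaces `Λ^{a,b}`, `a + b = k`, with
`a < c` — the complex conjugate of the Hodge filtration step `F^c H^k = ⊕_{a ≥ c} H^{a,k-a}`
(`H^{b,a} = \overline{H^{a,b}}`); for `k = 2p - 1`, `c = p` this is Lange's `\overline{F^pH^{2p-1}(M)}`,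
the tangent space of the Griffiths intermediate Jacobian. [cite: Lange2023AbelianVarietiesComplex, §5.4.2 (5.25)] -/
def lowerForms (k c : ℕ) : Submodule ℂ (E [⋀^Fin k]→L[ℝ] ℂ) :=
  ⨆ (pq : ↥(antidiagonal k)) (_ : pq.1.1 < c), typeSubmodule E k pq.1.1 pq.1.2

/-- `Λ^{a,b} ⊆ \overline{F^c H^k}` for `a + b = k`, `a < c`. [cite: Lange2023AbelianVarietiesComplex, §5.4.2 (5.25)] -/
theorem typeSubmodule_le_lowerForms {k c a b : ℕ} (hab : a + b = k) (hac : a < c) :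
    typeSubmodule E k a b ≤ lowerForms E k c :=
  le_iSup₂_of_le (f := fun (pq : ↥(antidiagonal k)) (_ : pq.1.1 < c) ↦ typeSubmodule E k pq.1.1 pq.1.2)
    ⟨(a, b), mem_antidiagonal.2 hab⟩ hac le_rfl

/-- A sum of type spaces is described by the vanishing of the complementary type components:
`ψ ∈ ⊕_{(a,b) ∈ S} Λ^{a,b}` iff `ψ^{a,b} = 0` for every `(a, b) ∉ S`, `a + b = k`. [cite: VoisinHodgeI2002, §2.3.1] -/
theorem mem_biSup_typeSubmodule_iff {k : ℕ} (S : ℕ × ℕ → Prop) (ψ : E [⋀^Fin k]→L[ℝ] ℂ) :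
    ψ ∈ ⨆ (pq : ↥(antidiagonal k)) (_ : S pq.1), typeSubmodule E k pq.1.1 pq.1.2 ↔
      ∀ pq ∈ antidiagonal k, ¬ S pq → typeProjAt pq.1 pq.2 ψ = 0 := by
  classical
  constructor
  · intro h
    refine Submodule.iSup_induction (p := fun (pq : ↥(antidiagonal k)) ↦ ⨆ (_ : S pq.1),
      typeSubmodule E k pq.1.1 pq.1.2)
      (motive := fun ψ ↦ ∀ pq ∈ antidiagonal k, ¬ S pq → typeProjAt pq.1 pq.2 ψ = 0) h
      (fun pq φ hφ pq' hpq' hS ↦ ?_) (fun pq _ _ ↦ Literature.Analysis.Complex.typeProjAt_zero _ _)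
      (fun φ φ' hφ hφ' pq hpq hS ↦ by rw [typeProjAt_add, hφ pq hpq hS, hφ' pq hpq hS, add_zero])
    by_cases hSpq : S pq.1
    · rw [iSup_pos hSpq] at hφ
      have hne : pq.1.1 ≠ pq'.1 ∨ pq.1.2 ≠ pq'.2 := by
        rcases ne_or_eq pq.1.1 pq'.1 with h1 | h1
        · exact Or.inl h1
        · exact Or.inr fun h2 ↦ hS (by rw [show pq' = pq.1 from (Prod.ext h1 h2).symm]; exact hSpq)
      exact (isOfTypeAt_of_mem_typeSubmodule (mem_antidiagonal.1 pq.2) hφ).typeProjAt_of_ne hne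
    · rw [iSup_neg hSpq, Submodule.mem_bot] at hφ
      rw [hφ, Literature.Analysis.Complex.typeProjAt_zero]
  · intro h
    rw [← sum_antidiagonal_typeProjAt ψ]
    refine Submodule.sum_mem _ fun pq hpq ↦ ?_
    by_cases hS : S pq
    · exact le_iSup₂_of_le (f := fun (pq : ↥(antidiagonal k)) (_ : S pq.1) ↦ typeSubmodule E k pq.1.1 pq.1.2)
        ⟨pq, hpq⟩ hS le_rfl ((isOfTypeAt_typeProjAt (mem_antidiagonal.1 hpq) ψ).mem_typeSubmodule)
    · rw [h pq hpq hS]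
      exact zero_mem _

/-- Membership in `\overline{F^c H^k}`: all type components `ψ^{a,b}` with `a ≥ c` vanish.
[cite: Lange2023AbelianVarietiesComplex, §5.4.2 (5.25)] -/
theorem mem_lowerForms_iff {k c : ℕ} (ψ : E [⋀^Fin k]→L[ℝ] ℂ) :
    ψ ∈ lowerForms E k c ↔ ∀ pq ∈ antidiagonal k, c ≤ pq.1 → typeProjAt pq.1 pq.2 ψ = 0 := by
  have h := mem_biSup_typeSubmodule_iff (fun pq : ℕ × ℕ ↦ pq.1 < c) ψ
  simp only [not_lt] at h
  exact h

/-- **The pieces of the Hodge–Lefschetz triangle, indexed by all of `ℕ × ℕ × ℕ`, are independent**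
(pieces off the line `2s + a + b = k` are zero). [cite: Lange2023AbelianVarietiesComplex, §5.4.2 Thm. 5.4.6 (5.28)] -/
theorem iSupIndep_hodgeLefschetzPiece' [FiniteDimensional ℂ E] {η : E [⋀^Fin 2]→L[ℝ] ℝ}
    (hη : ∀ v : E, v ≠ 0 → ∃ w : E, η ![v, w] ≠ 0) (h11 : ∀ u v : E, η ![I • u, I • v] = η ![u, v])
    (k : ℕ) (hk : k ≤ finrank ℂ E) :
    iSupIndep fun x : ℕ × ℕ × ℕ ↦ hodgeLefschetzPiece η k x.1 x.2.1 x.2.2 := by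
  have hind := iSupIndep_hodgeLefschetzPiece hη h11 k hk
  rw [iSupIndep_def] at hind ⊢
  intro x
  by_cases hx : 2 * x.1 + (x.2.1 + x.2.2) = k
  · refine (hind ⟨x, hx⟩).mono_right (iSup₂_le fun y hy ↦ ?_)
    by_cases hy' : 2 * y.1 + (y.2.1 + y.2.2) = k
    · exact le_iSup₂_of_le (f := fun (j : {x : ℕ × ℕ × ℕ // 2 * x.1 + (x.2.1 + x.2.2) = k})
          (_ : j ≠ ⟨x, hx⟩) ↦ hodgeLefschetzPiece η k j.1.1 j.1.2.1 j.1.2.2)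
        ⟨y, hy'⟩ (fun h ↦ hy (congrArg Subtype.val h)) le_rfl
    · rw [hodgeLefschetzPiece_eq_bot η hy']
      exact bot_le
  · rw [hodgeLefschetzPiece_eq_bot η hx]
    exact disjoint_bot_left

/-- The finite index set of the Hodge–Lefschetz triangle in degree `k`: the triples `(s, a, b)` with
`2s + a + b = k`. [cite: Lange2023AbelianVarietiesComplex, §5.4.2 Thm. 5.4.6 (5.28)] -/
def pieceIdx (k : ℕ) : Finset (ℕ × ℕ × ℕ) :=
  (Finset.range (k + 1) ×ˢ (Finset.range (k + 1) ×ˢ Finset.range (k + 1))).filter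
    fun x ↦ 2 * x.1 + (x.2.1 + x.2.2) = k

/-- Membership in `pieceIdx k`. [folklore] -/
private theorem mem_pieceIdx {k : ℕ} {x : ℕ × ℕ × ℕ} : x ∈ pieceIdx k ↔ 2 * x.1 + (x.2.1 + x.2.2) = k := by
  simp only [pieceIdx, Finset.mem_filter, Finset.mem_product, Finset.mem_range]
  constructor
  · exact fun h ↦ h.2
  · intro h
    exact ⟨⟨by omega, by omega, by omega⟩, h⟩

/-- **(5.28) as a finite sum: `H^k(X, ℂ) = Σ_{(s,a,b) ∈ pieceIdx k} Lˢ H_pr^{a,b}`** (`k ≤ g`).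
[cite: Lange2023AbelianVarietiesComplex, §5.4.2 Thm. 5.4.6 (5.28)] -/
theorem biSup_pieceIdx_hodgeLefschetzPiece_eq_top [FiniteDimensional ℂ E] {η : E [⋀^Fin 2]→L[ℝ] ℝ}
    (hη : ∀ v : E, v ≠ 0 → ∃ w : E, η ![v, w] ≠ 0) (h11 : ∀ u v : E, η ![I • u, I • v] = η ![u, v])
    (k : ℕ) (hk : k ≤ finrank ℂ E) :
    ⨆ x ∈ pieceIdx k, hodgeLefschetzPiece η k x.1 x.2.1 x.2.2 = ⊤ := by
  rw [eq_top_iff, ← iSup_hodgeLefschetzPiece_eq_top hη h11 k hk]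
  exact iSup_le fun x ↦ le_iSup₂_of_le (f := fun x (_ : x ∈ pieceIdx k) ↦ hodgeLefschetzPiece η k x.1 x.2.1 x.2.2)
    x.1 (mem_pieceIdx.2 x.2) le_rfl

/-- The pieces of the triangle lying in `\overline{F^c H^k}`: `(s, a, b)` with `2s + a + b = k` and
`s + a < c` (the piece `Lˢ H_pr^{a,b}` has Hodge type `(s+a, s+b)`). [cite: Lange2023AbelianVarietiesComplex, §5.4.2 Thm. 5.4.6 (Step V)] -/
def lowIdx (k c : ℕ) : Finset (ℕ × ℕ × ℕ) :=
  (pieceIdx k).filter fun x ↦ x.1 + x.2.1 < c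

/-- Membership in `lowIdx k c`. [folklore] -/
private theorem mem_lowIdx {k c : ℕ} {x : ℕ × ℕ × ℕ} :
    x ∈ lowIdx k c ↔ 2 * x.1 + (x.2.1 + x.2.2) = k ∧ x.1 + x.2.1 < c := by
  rw [lowIdx, Finset.mem_filter, mem_pieceIdx]

/-- **`\overline{F^c H^k}` is the sum of the triangle pieces of type below `c`**:
`\overline{F^cH^k} = Σ_{2s+a+b=k, s+a<c} Lˢ H_pr^{a,b}` (`k ≤ g`) — each Hodge summand `H^{a',b'}` is the
sum of the pieces `Lˢ H_pr^{a'-s,b'-s}` ((5.28) read type by type).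
[cite: Lange2023AbelianVarietiesComplex, §5.4.2 Thm. 5.4.6 (Step V)] -/
theorem lowerForms_eq_biSup_hodgeLefschetzPiece [FiniteDimensional ℂ E] {η : E [⋀^Fin 2]→L[ℝ] ℝ}
    (hη : ∀ v : E, v ≠ 0 → ∃ w : E, η ![v, w] ≠ 0) (h11 : ∀ u v : E, η ![I • u, I • v] = η ![u, v])
    {k : ℕ} (hk : k ≤ finrank ℂ E) (c : ℕ) :
    lowerForms E k c = ⨆ x ∈ lowIdx k c, hodgeLefschetzPiece η k x.1 x.2.1 x.2.2 := by
  classical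
  refine le_antisymm (iSup₂_le fun pq hpq ↦ fun y hy ↦ ?_) (iSup₂_le fun x hx ↦ ?_)
  · have hab : pq.1.1 + pq.1.2 = k := mem_antidiagonal.1 pq.2
    have hy' : y ∈ ⨆ x ∈ pieceIdx k, hodgeLefschetzPiece η k x.1 x.2.1 x.2.2 := by
      rw [biSup_pieceIdx_hodgeLefschetzPiece_eq_top hη h11 k hk]; trivial
    obtain ⟨μ, hμ⟩ := (Submodule.mem_iSup_finset_iff_exists_sum _ _).1 hy'
    have hyT : typeProjAt pq.1.1 pq.1.2 y = y := mem_typeSubmodule_iff.1 hy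
    rw [← hyT, ← hμ, ← typeProjₗ_apply, map_sum]
    refine Submodule.sum_mem _ fun x hx ↦ ?_
    rw [typeProjₗ_apply]
    have hx' := mem_pieceIdx.1 hx
    have hT : IsOfTypeAt (x.1 + x.2.1) (x.1 + x.2.2) (μ x : E [⋀^Fin k]→L[ℝ] ℂ) :=
      isOfTypeAt_of_mem_typeSubmodule (by omega) (hodgeLefschetzPiece_le_typeSubmodule h11 k _ _ _ (μ x).2)
    by_cases hxa : x.1 + x.2.1 = pq.1.1
    · have hxb : x.1 + x.2.2 = pq.1.2 := by omega
      rw [← hxa, ← hxb, hT.typeProjAt_eq_self]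
      exact le_iSup₂_of_le (f := fun x (_ : x ∈ lowIdx k c) ↦ hodgeLefschetzPiece η k x.1 x.2.1 x.2.2) x
        (mem_lowIdx.2 ⟨hx', by omega⟩) le_rfl (μ x).2
    · rw [hT.typeProjAt_of_ne (Or.inl hxa)]
      exact zero_mem _
  · obtain ⟨hx1, hx2⟩ := mem_lowIdx.1 hx
    exact (hodgeLefschetzPiece_le_typeSubmodule h11 k _ _ _).trans
      (typeSubmodule_le_lowerForms (by omega) hx2)

end Lower

/-! ## Part B2. Step V: the signature of `H_G^p` on `\overline{FᵖH^{2p-1}}` -/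

section Definite

variable {V : Type*} [AddCommGroup V] [Module ℂ V] (H : V →ₗ⋆[ℂ] V →ₗ[ℂ] ℂ)

/-- A finite sum of mutually `H`-orthogonal subspaces on each of which `H` is positive definite is
positive definite (`H(Σxᵢ, Σxᵢ) = Σ H(xᵢ, xᵢ)`). [cite: GohbergLancasterRodman2005, §2.3 Thm. 2.3.2 (proof)] -/
private theorem isPosDefOn_biSup {κ : Type*} (S : Finset κ) (U : κ → Submodule ℂ V)
    (hpos : ∀ i ∈ S, IsPosDefOn H (U i))
    (horth : ∀ i ∈ S, ∀ j ∈ S, i ≠ j → ∀ x ∈ U i, ∀ y ∈ U j, H x y = 0) :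
    IsPosDefOn H (⨆ i ∈ S, U i) := by
  classical
  intro x hx hx0
  obtain ⟨μ, hμ⟩ := (Submodule.mem_iSup_finset_iff_exists_sum _ _).1 hx
  have hdiag : H x x = ∑ i ∈ S, H (μ i) (μ i) := by
    rw [← hμ, map_sum H, LinearMap.sum_apply]
    refine Finset.sum_congr rfl fun i hi ↦ ?_
    rw [map_sum]
    exact Finset.sum_eq_single i (fun j hj hji ↦ horth i hi j hj (Ne.symm hji) _ (μ i).2 _ (μ j).2)
      (fun h ↦ absurd hi h)
  have hex : ∃ i ∈ S, (μ i : V) ≠ 0 := by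
    by_contra h
    apply hx0
    rw [← hμ]
    exact Finset.sum_eq_zero fun i hi ↦ not_ne_iff.1 fun hne ↦ h ⟨i, hi, hne⟩
  obtain ⟨i, hi, hμi⟩ := hex
  rw [hdiag, Complex.re_sum]
  refine Finset.sum_pos' (fun j hj ↦ ?_) ⟨i, hi, hpos i hi _ (μ i).2 hμi⟩
  by_cases hj0 : (μ j : V) = 0
  · rw [hj0, LinearMap.map_zero₂, Complex.zero_re]
  · exact (hpos j hj _ (μ j).2 hj0).le

/-- `H` is negative definite on `W` iff `-H` is positive definite on `W`. [folklore] -/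
private theorem isNegDefOn_iff_isPosDefOn_neg (W : Submodule ℂ V) : IsNegDefOn H W ↔ IsPosDefOn (-H) W := by
  simp only [IsNegDefOn, IsPosDefOn, LinearMap.neg_apply, Complex.neg_re, neg_pos]

/-- Negative-definite analogue of `isPosDefOn_biSup`. [cite: GohbergLancasterRodman2005, §2.3 Thm. 2.3.2 (proof)] -/
private theorem isNegDefOn_biSup {κ : Type*} (S : Finset κ) (U : κ → Submodule ℂ V)
    (hneg : ∀ i ∈ S, IsNegDefOn H (U i))
    (horth : ∀ i ∈ S, ∀ j ∈ S, i ≠ j → ∀ x ∈ U i, ∀ y ∈ U j, H x y = 0) :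
    IsNegDefOn H (⨆ i ∈ S, U i) := by
  rw [isNegDefOn_iff_isPosDefOn_neg]
  exact isPosDefOn_biSup (-H) S U (fun i hi ↦ (isNegDefOn_iff_isPosDefOn_neg H _).1 (hneg i hi))
    fun i hi j hj hij x hx y hy ↦ by rw [LinearMap.neg_apply, LinearMap.neg_apply, horth i hi j hj hij x hx y hy, neg_zero]

/-- Two finite sums of pairwise `H`-orthogonal subspaces are `H`-orthogonal. [folklore] -/
private theorem apply_eq_zero_of_mem_biSup {κ : Type*} (S T : Finset κ) (U : κ → Submodule ℂ V)
    (horth : ∀ i ∈ S, ∀ j ∈ T, ∀ x ∈ U i, ∀ y ∈ U j, H x y = 0) {x y : V} (hx : x ∈ ⨆ i ∈ S, U i)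
    (hy : y ∈ ⨆ j ∈ T, U j) : H x y = 0 := by
  classical
  obtain ⟨μ, rfl⟩ := (Submodule.mem_iSup_finset_iff_exists_sum _ _).1 hx
  obtain ⟨ν, rfl⟩ := (Submodule.mem_iSup_finset_iff_exists_sum _ _).1 hy
  rw [map_sum H, LinearMap.sum_apply]
  refine Finset.sum_eq_zero fun i hi ↦ ?_
  rw [map_sum]
  exact Finset.sum_eq_zero fun j hj ↦ horth i hi j hj _ (μ i).2 _ (ν j).2

end Definite

section StepV

variable {E : Type*} [NormedAddCommGroup E] [NormedSpace ℂ E]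

/-- **The pieces of case (a) of Step IV**, `Lˢ H_pr^{p-1-2t, p+2t-2s}`, `0 ≤ 2t ≤ p - 1`, `0 ≤ s ≤ 2t`
(those on which `H_G^p` is positive definite), as triples `(s, a, b)`: the image of
`(t, s) ↦ (s, p-1-2t, p+2t-2s)`. [cite: Lange2023AbelianVarietiesComplex, §5.4.2 Thm. 5.4.6 (Step IV (a))] -/
def posPieceIdx (p : ℕ) : Finset (ℕ × ℕ × ℕ) :=
  ((Finset.range ((p + 1) / 2)).sigma fun t ↦ Finset.range (2 * t + 1)).image
    fun ts ↦ (ts.2, p - 1 - 2 * ts.1, p + 2 * ts.1 - 2 * ts.2)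

/-- **The pieces of case (b) of Step IV**, `Lˢ H_pr^{p-2-2t, p+2t-2s+1}`, `0 ≤ 2t ≤ p - 2`,
`0 ≤ s ≤ 2t + 1` (those on which `H_G^p` is negative definite), as triples `(s, a, b)`: the image of
`(t, s) ↦ (s, p-2-2t, p+1+2t-2s)`. [cite: Lange2023AbelianVarietiesComplex, §5.4.2 Thm. 5.4.6 (Step IV (b))] -/
def negPieceIdx (p : ℕ) : Finset (ℕ × ℕ × ℕ) :=
  ((Finset.range (p / 2)).sigma fun t ↦ Finset.range (2 * t + 2)).image
    fun ts ↦ (ts.2, p - 2 - 2 * ts.1, p + 1 + 2 * ts.1 - 2 * ts.2)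

/-- Membership in `posPieceIdx p`: `a + 2t + 1 = p`, `s ≤ 2t`, `b + 2s = p + 2t`. [folklore] -/
private theorem mem_posPieceIdx {p : ℕ} {x : ℕ × ℕ × ℕ} :
    x ∈ posPieceIdx p ↔ ∃ t, x.2.1 + 2 * t + 1 = p ∧ x.1 ≤ 2 * t ∧ x.2.2 + 2 * x.1 = p + 2 * t := by
  simp only [posPieceIdx, Finset.mem_image, Finset.mem_sigma, Finset.mem_range]
  constructor
  · rintro ⟨⟨t, s⟩, ⟨ht, hs⟩, rfl⟩
    dsimp only at ht hs ⊢
    exact ⟨t, by omega, by omega, by omega⟩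
  · rintro ⟨t, h1, h2, h3⟩
    refine ⟨⟨t, x.1⟩, ⟨?_, ?_⟩, Prod.ext rfl (Prod.ext ?_ ?_)⟩ <;> dsimp only <;> omega

/-- Membership in `negPieceIdx p`: `a + 2t + 2 = p`, `s ≤ 2t + 1`, `b + 2s = p + 1 + 2t`. [folklore] -/
private theorem mem_negPieceIdx {p : ℕ} {x : ℕ × ℕ × ℕ} :
    x ∈ negPieceIdx p ↔ ∃ t, x.2.1 + 2 * t + 2 = p ∧ x.1 ≤ 2 * t + 1 ∧ x.2.2 + 2 * x.1 = p + 1 + 2 * t := by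
  simp only [negPieceIdx, Finset.mem_image, Finset.mem_sigma, Finset.mem_range]
  constructor
  · rintro ⟨⟨t, s⟩, ⟨ht, hs⟩, rfl⟩
    dsimp only at ht hs ⊢
    exact ⟨t, by omega, by omega, by omega⟩
  · rintro ⟨t, h1, h2, h3⟩
    refine ⟨⟨t, x.1⟩, ⟨?_, ?_⟩, Prod.ext rfl (Prod.ext ?_ ?_)⟩ <;> dsimp only <;> omega

/-- **Cases (a) and (b) exhaust the pieces in `\overline{FᵖH^{2p-1}}`**: a triple `(s, a, b)` with
`2s + a + b = 2p - 1` and `s + a < p` falls under (a) or (b) according to the parity of `p - 1 - a`.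
[cite: Lange2023AbelianVarietiesComplex, §5.4.2 Thm. 5.4.6 (Step IV)] -/
theorem lowIdx_eq_posPieceIdx_union_negPieceIdx {k p : ℕ} (hkp : k + 1 = 2 * p) :
    lowIdx k p = posPieceIdx p ∪ negPieceIdx p := by
  ext x
  rw [Finset.mem_union, mem_lowIdx, mem_posPieceIdx, mem_negPieceIdx]
  constructor
  · rintro ⟨hx, hlow⟩
    rcases Nat.even_or_odd (p - 1 - x.2.1) with ⟨t, ht⟩ | ⟨t, ht⟩
    · exact Or.inl ⟨t, by omega, by omega, by omega⟩
    · exact Or.inr ⟨t, by omega, by omega, by omega⟩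
  · rintro (⟨t, h1, h2, h3⟩ | ⟨t, h1, h2, h3⟩)
    · exact ⟨by omega, by omega⟩
    · exact ⟨by omega, by omega⟩

/-- Cases (a) and (b) are disjoint (the parities of `p - 1 - a` differ). [cite: Lange2023AbelianVarietiesComplex, §5.4.2 Thm. 5.4.6 (Step IV)] -/
theorem disjoint_posPieceIdx_negPieceIdx (p : ℕ) : Disjoint (posPieceIdx p) (negPieceIdx p) :=
  Finset.disjoint_left.2 fun x hx hx' ↦ by
    obtain ⟨t, h1, -, -⟩ := mem_posPieceIdx.1 hx
    obtain ⟨t', h1', -, -⟩ := mem_negPieceIdx.1 hx'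
    omega

/-- Equality of triples from equality of their components. [folklore] -/
private theorem triple_eq {x y : ℕ × ℕ × ℕ} (h : (x.1, x.2.1, x.2.2) = (y.1, y.2.1, y.2.2)) : x = y := by
  simp only [Prod.mk.injEq] at h
  exact Prod.ext h.1 (Prod.ext h.2.1 h.2.2)

/-- **The positive part of `\overline{FᵖH^{2p-1}}`**: the sum of the pieces of case (a),
`Σ Lˢ H_pr^{p-1-2t, p+2t-2s}`. [cite: Lange2023AbelianVarietiesComplex, §5.4.2 Thm. 5.4.6 (Step IV (a))] -/
def griffithsPos (η : E [⋀^Fin 2]→L[ℝ] ℝ) (k p : ℕ) : Submodule ℂ (E [⋀^Fin k]→L[ℝ] ℂ) :=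
  ⨆ x ∈ posPieceIdx p, hodgeLefschetzPiece η k x.1 x.2.1 x.2.2

/-- **The negative part of `\overline{FᵖH^{2p-1}}`**: the sum of the pieces of case (b),
`Σ Lˢ H_pr^{p-2-2t, p+2t-2s+1}`. [cite: Lange2023AbelianVarietiesComplex, §5.4.2 Thm. 5.4.6 (Step IV (b))] -/
def griffithsNeg (η : E [⋀^Fin 2]→L[ℝ] ℝ) (k p : ℕ) : Submodule ℂ (E [⋀^Fin k]→L[ℝ] ℂ) :=
  ⨆ x ∈ negPieceIdx p, hodgeLefschetzPiece η k x.1 x.2.1 x.2.2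

/-- The positive part lies in `\overline{FᵖH^{2p-1}}`. [cite: Lange2023AbelianVarietiesComplex, §5.4.2 Thm. 5.4.6 (Step V)] -/
theorem griffithsPos_le_lowerForms {η : E [⋀^Fin 2]→L[ℝ] ℝ} (h11 : ∀ u v : E, η ![I • u, I • v] = η ![u, v])
    {k p : ℕ} (hkp : k + 1 = 2 * p) : griffithsPos η k p ≤ lowerForms E k p :=
  iSup₂_le fun x hx ↦ by
    obtain ⟨t, h1, h2, h3⟩ := mem_posPieceIdx.1 hx
    exact (hodgeLefschetzPiece_le_typeSubmodule h11 k _ _ _).trans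
      (typeSubmodule_le_lowerForms (by omega) (by omega))

/-- The negative part lies in `\overline{FᵖH^{2p-1}}`. [cite: Lange2023AbelianVarietiesComplex, §5.4.2 Thm. 5.4.6 (Step V)] -/
theorem griffithsNeg_le_lowerForms {η : E [⋀^Fin 2]→L[ℝ] ℝ} (h11 : ∀ u v : E, η ![I • u, I • v] = η ![u, v])
    {k p : ℕ} (hkp : k + 1 = 2 * p) : griffithsNeg η k p ≤ lowerForms E k p :=
  iSup₂_le fun x hx ↦ by
    obtain ⟨t, h1, h2, h3⟩ := mem_negPieceIdx.1 hx
    exact (hodgeLefschetzPiece_le_typeSubmodule h11 k _ _ _).trans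
      (typeSubmodule_le_lowerForms (by omega) (by omega))

/-- **`\overline{FᵖH^{2p-1}} = (positive part) + (negative part)`** (`2p - 1 ≤ g`).
[cite: Lange2023AbelianVarietiesComplex, §5.4.2 Thm. 5.4.6 (Step V)] -/
theorem griffithsPos_sup_griffithsNeg [FiniteDimensional ℂ E] {η : E [⋀^Fin 2]→L[ℝ] ℝ}
    (hη : ∀ v : E, v ≠ 0 → ∃ w : E, η ![v, w] ≠ 0) (h11 : ∀ u v : E, η ![I • u, I • v] = η ![u, v])
    {k p : ℕ} (hkp : k + 1 = 2 * p) (hk : k ≤ finrank ℂ E) :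
    griffithsPos η k p ⊔ griffithsNeg η k p = lowerForms E k p := by
  rw [lowerForms_eq_biSup_hodgeLefschetzPiece hη h11 hk p, lowIdx_eq_posPieceIdx_union_negPieceIdx hkp,
    Finset.iSup_union]
  rfl

variable {ι : Type*} [Fintype ι] [DecidableEq ι] (Φ : (ι → ℝ) ≃L[ℝ] E) [FiniteDimensional ℂ E]

/-- **Step V (a): `H_G^p` is positive definite on the positive part** (the pieces of (a) are positive
definite by Step IV and pairwise orthogonal by Step III). [cite: Lange2023AbelianVarietiesComplex, §5.4.2 Thm. 5.4.6 (Step V)] -/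
theorem IsRiemannForm.isPosDefOn_griffithsForm_griffithsPos {η : E [⋀^Fin 2]→L[ℝ] ℝ} (hη : IsRiemannForm Φ η)
    {g : ℕ} (e : Fin (2 * g) ≃ ι) {k r p : ℕ} (hkr : k + r = g) (hkp : k + 1 = 2 * p) :
    IsPosDefOn (griffithsForm Φ η e hkr p) (griffithsPos η k p) := by
  have h11 := (hη.isNSForm Φ).type_one_one
  refine isPosDefOn_biSup _ _ _ (fun x hx ↦ ?_) fun x hx y hy hxy φ hφ ψ hψ ↦
    griffithsForm_eq_zero_of_mem_hodgeLefschetzPiece_of_ne Φ η h11 e hkr p (fun h ↦ hxy (triple_eq h).symm) hψ hφ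
  obtain ⟨t, h1, h2, h3⟩ := mem_posPieceIdx.1 hx
  exact hη.isPosDefOn_griffithsForm_hodgeLefschetzPiece Φ e hkr hkp (t := t) (by omega) (by omega)

/-- **Step V (b): `H_G^p` is negative definite on the negative part.** [cite: Lange2023AbelianVarietiesComplex, §5.4.2 Thm. 5.4.6 (Step V)] -/
theorem IsRiemannForm.isNegDefOn_griffithsForm_griffithsNeg {η : E [⋀^Fin 2]→L[ℝ] ℝ} (hη : IsRiemannForm Φ η)
    {g : ℕ} (e : Fin (2 * g) ≃ ι) {k r p : ℕ} (hkr : k + r = g) (hkp : k + 1 = 2 * p) :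
    IsNegDefOn (griffithsForm Φ η e hkr p) (griffithsNeg η k p) := by
  have h11 := (hη.isNSForm Φ).type_one_one
  refine isNegDefOn_biSup _ _ _ (fun x hx ↦ ?_) fun x hx y hy hxy φ hφ ψ hψ ↦
    griffithsForm_eq_zero_of_mem_hodgeLefschetzPiece_of_ne Φ η h11 e hkr p (fun h ↦ hxy (triple_eq h).symm) hψ hφ
  obtain ⟨t, h1, h2, h3⟩ := mem_negPieceIdx.1 hx
  exact hη.isNegDefOn_griffithsForm_hodgeLefschetzPiece Φ e hkr hkp (t := t) (by omega) (by omega)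

/-- **Step V: the positive and the negative part are `H_G^p`-orthogonal** (Step III).
[cite: Lange2023AbelianVarietiesComplex, §5.4.2 Thm. 5.4.6 (Step V)] -/
theorem griffithsForm_eq_zero_of_mem_griffithsPos_of_mem_griffithsNeg {η : E [⋀^Fin 2]→L[ℝ] ℝ}
    (h11 : ∀ u v : E, η ![I • u, I • v] = η ![u, v]) {g : ℕ} (e : Fin (2 * g) ≃ ι) {k r : ℕ}
    (hkr : k + r = g) (p : ℕ) {x y : E [⋀^Fin k]→L[ℝ] ℂ} (hx : x ∈ griffithsPos η k p)
    (hy : y ∈ griffithsNeg η k p) :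
    griffithsForm Φ η e hkr p x y = 0 ∧ griffithsForm Φ η e hkr p y x = 0 := by
  have hd := disjoint_posPieceIdx_negPieceIdx p
  refine ⟨apply_eq_zero_of_mem_biSup _ _ _ _ (fun i hi j hj φ hφ ψ hψ ↦ ?_) hx hy,
    apply_eq_zero_of_mem_biSup _ _ _ _ (fun i hi j hj φ hφ ψ hψ ↦ ?_) hy hx⟩
  · exact griffithsForm_eq_zero_of_mem_hodgeLefschetzPiece_of_ne Φ η h11 e hkr p
      (fun h : (j.1, j.2.1, j.2.2) = (i.1, i.2.1, i.2.2) ↦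
        Finset.disjoint_left.1 hd hi (triple_eq h ▸ hj)) hψ hφ
  · exact griffithsForm_eq_zero_of_mem_hodgeLefschetzPiece_of_ne Φ η h11 e hkr p
      (fun h : (j.1, j.2.1, j.2.2) = (i.1, i.2.1, i.2.2) ↦
        Finset.disjoint_left.1 hd hj (triple_eq h ▸ hi)) hψ hφ

/-- **Step V, Sylvester: an `H_G^p`-negative-definite complex subspace of `\overline{FᵖH^{2p-1}}` has
dimension at most that of the negative part** (law of inertia for the orthogonal splitting
`\overline{FᵖH^{2p-1}} = (pos) ⊕ (neg)`). [cite: Lange2023AbelianVarietiesComplex, §5.4.2 Thm. 5.4.6 (Step V)]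
[cite: GohbergLancasterRodman2005, §2.3 Thm. 2.3.2] -/
theorem IsRiemannForm.finrank_le_finrank_griffithsNeg {η : E [⋀^Fin 2]→L[ℝ] ℝ} (hη : IsRiemannForm Φ η)
    {g : ℕ} (e : Fin (2 * g) ≃ ι) {k r p : ℕ} (hkr : k + r = g) (hkp : k + 1 = 2 * p)
    {N : Submodule ℂ (E [⋀^Fin k]→L[ℝ] ℂ)} (hN : N ≤ lowerForms E k p)
    (hneg : IsNegDefOn (griffithsForm Φ η e hkr p) N) :
    finrank ℂ N ≤ finrank ℂ (griffithsNeg η k p) := by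
  have hg : finrank ℂ E = g := finrank_eq_of_finTwoMulEquiv Φ e
  haveI := finiteDimensional_alt_of_le (E := E) (k := k) (by omega)
  have h11 := (hη.isNSForm Φ).type_one_one
  have hdisj : Disjoint (griffithsPos η k p) N :=
    Literature.AlgebraicGeometry.Motives.disjoint_of_isPosDefOn_of_isNegDefOn
      (hη.isPosDefOn_griffithsForm_griffithsPos Φ e hkr hkp) hneg
  have h1 := Submodule.finrank_sup_add_finrank_inf_eq (griffithsPos η k p) N
  rw [hdisj.eq_bot, finrank_bot, add_zero] at h1
  have h2 : finrank ℂ ↥(griffithsPos η k p ⊔ N) ≤ finrank ℂ ↥(lowerForms E k p) :=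
    Submodule.finrank_mono (sup_le (griffithsPos_le_lowerForms h11 hkp) hN)
  have h3 := Submodule.finrank_sup_add_finrank_inf_eq (griffithsPos η k p) (griffithsNeg η k p)
  rw [griffithsPos_sup_griffithsNeg (hη.exists_apply_ne_zero Φ) h11 hkp (by omega)] at h3
  omega

/-- **Thm. 5.4.6: `H_G^p` is non-degenerate on `\overline{FᵖH^{2p-1}}`** (`2p - 1 ≤ g`): for
`0 ≠ x = x₊ + x₋`, `H_G^p(x, x₊) = H_G^p(x₊, x₊) > 0` if `x₊ ≠ 0`, else `H_G^p(x, x₋) < 0`.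
[cite: Lange2023AbelianVarietiesComplex, §5.4.2 Thm. 5.4.6] -/
theorem IsRiemannForm.exists_griffithsForm_ne_zero {η : E [⋀^Fin 2]→L[ℝ] ℝ} (hη : IsRiemannForm Φ η)
    {g : ℕ} (e : Fin (2 * g) ≃ ι) {k r p : ℕ} (hkr : k + r = g) (hkp : k + 1 = 2 * p)
    {x : E [⋀^Fin k]→L[ℝ] ℂ} (hx : x ∈ lowerForms E k p) (hx0 : x ≠ 0) :
    ∃ y ∈ lowerForms E k p, griffithsForm Φ η e hkr p x y ≠ 0 := by
  have hg : finrank ℂ E = g := finrank_eq_of_finTwoMulEquiv Φ e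
  have h11 := (hη.isNSForm Φ).type_one_one
  rw [← griffithsPos_sup_griffithsNeg (hη.exists_apply_ne_zero Φ) h11 hkp (by omega)] at hx
  obtain ⟨u, hu, v, hv, rfl⟩ := Submodule.mem_sup.1 hx
  have horth := griffithsForm_eq_zero_of_mem_griffithsPos_of_mem_griffithsNeg Φ h11 e hkr p hu hv
  by_cases hu0 : u = 0
  · have hv0 : v ≠ 0 := fun h ↦ hx0 (by rw [hu0, h, add_zero])
    refine ⟨v, griffithsNeg_le_lowerForms h11 hkp hv, fun h ↦ ?_⟩
    have hlt := hη.isNegDefOn_griffithsForm_griffithsNeg Φ e hkr hkp v hv hv0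
    rw [hu0, zero_add] at h
    rw [h, Complex.zero_re] at hlt
    exact lt_irrefl _ hlt
  · refine ⟨u, griffithsPos_le_lowerForms h11 hkp hu, fun h ↦ ?_⟩
    have hlt := hη.isPosDefOn_griffithsForm_griffithsPos Φ e hkr hkp u hu hu0
    rw [map_add, LinearMap.add_apply, horth.2, add_zero] at h
    rw [h, Complex.zero_re] at hlt
    exact lt_irrefl _ hlt

end StepV

/-! ## Part B3. The count: `dim (negative part) = i(p)` -/

section FinrankSum

variable {K : Type*} [DivisionRing K] {X : Type*} [AddCommGroup X] [Module K X]

/-- `dim (⊕_{k ∈ s} U_k) = Σ_{k ∈ s} dim U_k` for an independent family (copy of the tree's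
`Motives.finrank_biSup_eq_sum_of_iSupIndep`, whose file is not imported here). [folklore] -/
private theorem finrank_biSup_eq_sum_of_iSupIndep' [FiniteDimensional K X] {κ : Type*}
    {U : κ → Submodule K X} (hU : iSupIndep U) (s : Finset κ) :
    finrank K ↥(⨆ k ∈ s, U k) = ∑ k ∈ s, finrank K (U k) := by
  classical
  induction s using Finset.induction_on with
  | empty => simp
  | insert a s ha ih =>
    rw [Finset.iSup_insert, Finset.sum_insert ha, ← ih]
    have hdisj : Disjoint (U a) (⨆ k ∈ s, U k) := by
      have h := hU.disjoint_biSup (x := a) (y := (↑s : Set κ)) (by simpa using ha)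
      simpa using h
    have h := Submodule.finrank_sup_add_finrank_inf_eq (U a) (⨆ k ∈ s, U k)
    rwa [hdisj.eq_bot, finrank_bot, add_zero] at h

end FinrankSum

section Count

variable {E : Type*} [NormedAddCommGroup E] [NormedSpace ℂ E]

/-- **The dimension of `H_pr^{a,b}` of a `g`-dimensional complex torus**:
`dim H_pr^{a,b} = h^{a,b} - h^{a-1,b-1}` with `h^{a,b} = C(g,a)·C(g,b)` and `h^{-1,·} = h^{·,-1} = 0`
((5.29) and Exercise 5.4.6 (3): `h^{p,q} = C(g,p)C(g,q)` for an abelian variety).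
[cite: Lange2023AbelianVarietiesComplex, §5.4.2 Thm. 5.4.6 (5.29)] [cite: Lange2023AbelianVarietiesComplex, §5.4.6 Exercise (3)] -/
def primitiveHodgeNumber (g a b : ℕ) : ℕ :=
  g.choose a * g.choose b - if a = 0 ∨ b = 0 then 0 else g.choose (a - 1) * g.choose (b - 1)

/-- **(5.29): `dim H_pr^{a,b} = h^{a,b} - h^{a-1,b-1}`** for the primitive forms of a non-degenerate real
`(1,1)`-form on a `g`-dimensional space, `a + b ≤ g`. [cite: Lange2023AbelianVarietiesComplex, §5.4.2 Thm. 5.4.6 (5.29)] -/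
theorem finrank_primitiveForms_inf_typeSubmodule [FiniteDimensional ℂ E] {η : E [⋀^Fin 2]→L[ℝ] ℝ}
    (hη : ∀ v : E, v ≠ 0 → ∃ w : E, η ![v, w] ≠ 0) (h11 : ∀ u v : E, η ![I • u, I • v] = η ![u, v])
    {m a b : ℕ} (hab : a + b = m) (hm : m ≤ finrank ℂ E) :
    finrank ℂ ↥(primitiveForms η m ⊓ typeSubmodule E m a b) = primitiveHodgeNumber (finrank ℂ E) a b := by
  rcases Nat.eq_zero_or_pos a with rfl | ha
  · subst hab
    rw [zero_add] at hm ⊢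
    rw [finrank_primitiveForms_inf_typeSubmodule_zero_left hη h11 hm, primitiveHodgeNumber,
      if_pos (Or.inl rfl), Nat.choose_zero_right, one_mul, Nat.sub_zero]
  rcases Nat.eq_zero_or_pos b with rfl | hb
  · subst hab
    rw [add_zero] at hm ⊢
    rw [finrank_primitiveForms_inf_typeSubmodule_zero_right hη h11 hm, primitiveHodgeNumber,
      if_pos (Or.inr rfl), Nat.choose_zero_right, mul_one, Nat.sub_zero]
  obtain ⟨a₀, rfl⟩ : ∃ a₀, a = 1 + a₀ := ⟨a - 1, by omega⟩
  obtain ⟨b₀, rfl⟩ : ∃ b₀, b = 1 + b₀ := ⟨b - 1, by omega⟩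
  have h := finrank_primitiveForms_inf_typeSubmodule_succ hη h11 (m := a₀ + b₀) (k := m) (by omega) hm rfl
  rw [primitiveHodgeNumber, if_neg (by omega), Nat.add_sub_cancel_left, Nat.add_sub_cancel_left]
  omega

/-- **The index `i(p)` of Theorem 5.4.6** for a `g`-dimensional abelian variety (`h^{r,s} = C(g,r)C(g,s)`):
`i(p) = Σ_{t=0}^{[(p-2)/2]} Σ_{s=0}^{1+2t} (h^{p-2-2t, p+1-2s+2t} - h^{p-3-2t, p-2s+2t})`, the sum of the
dimensions `dim H_pr^{p-2-2t, p+2t-2s+1}` of the pieces of case (b).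
[cite: Lange2023AbelianVarietiesComplex, §5.4.2 Thm. 5.4.6] -/
def griffithsIndex (g p : ℕ) : ℕ :=
  ∑ t ∈ Finset.range (p / 2), ∑ s ∈ Finset.range (2 * t + 2),
    primitiveHodgeNumber g (p - 2 - 2 * t) (p + 1 + 2 * t - 2 * s)

/-- **Validation (Prop. 5.4.9, abelian threefold, `p = 2`)**: `i(2) = h^{0,3} + h^{0,1} = 1 + 3 = 4` for
`g = 3`. [cite: Lange2023AbelianVarietiesComplex, §5.4.2 Prop. 5.4.9] -/
theorem griffithsIndex_three_two : griffithsIndex 3 2 = 4 := by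
  decide

/-- **Validation (`p = 1`, the dual abelian variety)**: `i(1) = 0` — `H_G^1` is positive definite.
[cite: Lange2023AbelianVarietiesComplex, §5.4.2 Thm. 5.4.6] -/
theorem griffithsIndex_one (g : ℕ) : griffithsIndex g 1 = 0 := by
  simp [griffithsIndex]

variable [FiniteDimensional ℂ E]

/-- **Step V, the count: `dim (negative part) = Σ_{(b)} dim H_pr^{a,b}`** ("the index of `H_G^p` is the
sum of the dimensions of the spaces in (b)"; `Lˢ` is injective on these pieces by (5.28)).
[cite: Lange2023AbelianVarietiesComplex, §5.4.2 Thm. 5.4.6 (Step V)] -/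
theorem finrank_griffithsNeg {η : E [⋀^Fin 2]→L[ℝ] ℝ} (hη : ∀ v : E, v ≠ 0 → ∃ w : E, η ![v, w] ≠ 0)
    (h11 : ∀ u v : E, η ![I • u, I • v] = η ![u, v]) {k p : ℕ} (hkp : k + 1 = 2 * p)
    (hk : k ≤ finrank ℂ E) :
    finrank ℂ (griffithsNeg η k p) =
      ∑ x ∈ negPieceIdx p, finrank ℂ ↥(primitiveForms η (x.2.1 + x.2.2) ⊓
        typeSubmodule E (x.2.1 + x.2.2) x.2.1 x.2.2) := by
  haveI := finiteDimensional_alt_of_le (E := E) (k := k) (by omega)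
  rw [griffithsNeg, finrank_biSup_eq_sum_of_iSupIndep' (iSupIndep_hodgeLefschetzPiece' hη h11 k hk)]
  refine Finset.sum_congr rfl fun x hx ↦ ?_
  obtain ⟨t, h1, h2, h3⟩ := mem_negPieceIdx.1 hx
  exact finrank_hodgeLefschetzPiece hη (by omega) (by omega)

/-- **THEOREM 5.4.6, the index formula on forms: `dim (negative part of \overline{FᵖH^{2p-1}}) = i(p)`**
for a non-degenerate real `(1,1)`-form on a `g`-dimensional space and `2p - 1 ≤ g`.
[cite: Lange2023AbelianVarietiesComplex, §5.4.2 Thm. 5.4.6] -/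
theorem finrank_griffithsNeg_eq_griffithsIndex {η : E [⋀^Fin 2]→L[ℝ] ℝ}
    (hη : ∀ v : E, v ≠ 0 → ∃ w : E, η ![v, w] ≠ 0) (h11 : ∀ u v : E, η ![I • u, I • v] = η ![u, v])
    {k p : ℕ} (hkp : k + 1 = 2 * p) (hk : k ≤ finrank ℂ E) :
    finrank ℂ (griffithsNeg η k p) = griffithsIndex (finrank ℂ E) p := by
  rw [finrank_griffithsNeg hη h11 hkp hk, griffithsIndex, negPieceIdx, Finset.sum_image, Finset.sum_sigma]
  · refine Finset.sum_congr rfl fun t ht ↦ Finset.sum_congr rfl fun s hs ↦ ?_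
    rw [Finset.mem_range] at ht hs
    dsimp only
    exact finrank_primitiveForms_inf_typeSubmodule hη h11 rfl (by omega)
  · rintro ⟨t, s⟩ hts ⟨t', s'⟩ hts' h
    simp only [Finset.mem_coe, Finset.mem_sigma, Finset.mem_range] at hts hts'
    simp only [Prod.mk.injEq] at h
    obtain ⟨rfl, h2, -⟩ := h
    have htt : t = t' := by omega
    subst htt
    rfl

end Count

/-! ## Part B4. Transport to the Griffiths intermediate Jacobian `J_G^p(X)` of the torus -/

open Literature.AlgebraicGeometry.Motives Literature.AlgebraicGeometry.Motives.HodgeStructure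
open Literature.AlgebraicGeometry.HodgeTheory

-- `Hᵏ(X, ℚ)` is finite-dimensional: the instance `instModuleFiniteRationalForms` of
-- `ComplexTorusPoincareDualityHodgeStructure` (imported for it) is what `griffithsPeriod (hodgeStructure Φ k)` needs.

section RatForm

variable {ι : Type*} [Fintype ι] [DecidableEq ι] {E : Type*} [NormedAddCommGroup E] [NormedSpace ℂ E]
  (Φ : (ι → ℝ) ≃L[ℝ] E) {η : E [⋀^Fin 2]→L[ℝ] ℝ}

/-- The rational value `Q_k(γ, δ) ∈ ℚ` of the Lefschetz intersection form on rational classes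
(`exists_rat_lefschetzIntersectionForm_eq`). [cite: VoisinHodgeI2002, §7.1.2 (PDF p. 134)] -/
def IsNSForm.ratPairing (hη : IsNSForm Φ η) {g : ℕ} (e : Fin (2 * g) ≃ ι) {k r : ℕ} (hkr : k + r = g)
    (γ δ : rationalForms Φ k) : ℚ :=
  (exists_rat_lefschetzIntersectionForm_eq Φ η (hη.ofRealForm_mem_rationalForms Φ) e hkr γ.2 δ.2).choose

omit [Fintype ι] in
/-- `(ratPairing γ δ : ℂ) = Q_k(γ, δ)`. [cite: VoisinHodgeI2002, §7.1.2 (PDF p. 134)] -/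
theorem IsNSForm.cast_ratPairing (hη : IsNSForm Φ η) {g : ℕ} (e : Fin (2 * g) ≃ ι) {k r : ℕ}
    (hkr : k + r = g) (γ δ : rationalForms Φ k) :
    ((hη.ratPairing Φ e hkr γ δ : ℚ) : ℂ) =
      lefschetzIntersectionForm Φ η e hkr (γ : E [⋀^Fin k]→L[ℝ] ℂ) (δ : E [⋀^Fin k]→L[ℝ] ℂ) :=
  (exists_rat_lefschetzIntersectionForm_eq Φ η (hη.ofRealForm_mem_rationalForms Φ) e hkr γ.2
    δ.2).choose_spec.symm

/-- **Lange's alternating form `E = (-1)ᵖ Q_k` of (5.26) on `Hᵏ(X, ℚ)`** (`Q_k(φ, ψ) = ∫_X ω^{n-k} ∧ φ ∧ ψ`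
the Lefschetz intersection form of the polarisation, `k = 2p - 1` in the application), as a `ℚ`-bilinear
form on the rational forms carrier `rationalForms Φ k`. [cite: Lange2023AbelianVarietiesComplex, §5.4.2 (5.26)] -/
def IsNSForm.griffithsRatForm (hη : IsNSForm Φ η) {g : ℕ} (e : Fin (2 * g) ≃ ι) {k r : ℕ} (hkr : k + r = g)
    (p : ℕ) : LinearMap.BilinForm ℚ (rationalForms Φ k) :=
  LinearMap.mk₂ ℚ (fun γ δ ↦ (-1) ^ p * hη.ratPairing Φ e hkr γ δ)
    (fun γ γ' δ ↦ by
      apply Rat.cast_injective (α := ℂ)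
      push_cast
      rw [hη.cast_ratPairing, hη.cast_ratPairing, hη.cast_ratPairing, Submodule.coe_add, map_add,
        LinearMap.add_apply, mul_add])
    (fun c γ δ ↦ by
      apply Rat.cast_injective (α := ℂ)
      rw [smul_eq_mul]
      push_cast
      rw [hη.cast_ratPairing, hη.cast_ratPairing, Submodule.coe_smul, ← Rat.cast_smul_eq_qsmul ℂ c,
        map_smul, LinearMap.smul_apply, smul_eq_mul]
      ring)
    (fun γ δ δ' ↦ by
      apply Rat.cast_injective (α := ℂ)
      push_cast
      rw [hη.cast_ratPairing, hη.cast_ratPairing, hη.cast_ratPairing, Submodule.coe_add, map_add, mul_add])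
    (fun c γ δ ↦ by
      apply Rat.cast_injective (α := ℂ)
      rw [smul_eq_mul]
      push_cast
      rw [hη.cast_ratPairing, hη.cast_ratPairing, Submodule.coe_smul, ← Rat.cast_smul_eq_qsmul ℂ c,
        map_smul, smul_eq_mul]
      ring)

omit [Fintype ι] in
/-- **`(E(γ, δ) : ℂ) = (-1)ᵖ Q_k(γ, δ)`.** [cite: Lange2023AbelianVarietiesComplex, §5.4.2 (5.26)] -/
theorem IsNSForm.coe_griffithsRatForm (hη : IsNSForm Φ η) {g : ℕ} (e : Fin (2 * g) ≃ ι) {k r : ℕ}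
    (hkr : k + r = g) (p : ℕ) (γ δ : rationalForms Φ k) :
    ((hη.griffithsRatForm Φ e hkr p γ δ : ℚ) : ℂ) =
      (-1) ^ p * lefschetzIntersectionForm Φ η e hkr (γ : E [⋀^Fin k]→L[ℝ] ℂ) (δ : E [⋀^Fin k]→L[ℝ] ℂ) := by
  rw [IsNSForm.griffithsRatForm, LinearMap.mk₂_apply]
  push_cast
  rw [hη.cast_ratPairing]

omit [Fintype ι] in
/-- **`E` is alternating for odd `k`**: `E(δ, γ) = -E(γ, δ)` (`Q_k` is `(-1)ᵏ`-symmetric, Lemma 5.4.3 (a)).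
[cite: Lange2023AbelianVarietiesComplex, §5.4.1 Lemma 5.4.3 (a)] -/
theorem IsNSForm.griffithsRatForm_swap (hη : IsNSForm Φ η) {g : ℕ} (e : Fin (2 * g) ≃ ι) {k r : ℕ}
    (hkr : k + r = g) (p : ℕ) (hodd : Odd k) (γ δ : rationalForms Φ k) :
    hη.griffithsRatForm Φ e hkr p δ γ = -hη.griffithsRatForm Φ e hkr p γ δ := by
  apply Rat.cast_injective (α := ℂ)
  rw [Rat.cast_neg, hη.coe_griffithsRatForm, hη.coe_griffithsRatForm,
    lefschetzIntersectionForm_flip Φ η e hkr (γ : E [⋀^Fin k]→L[ℝ] ℂ) (δ : E [⋀^Fin k]→L[ℝ] ℂ),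
    hodd.neg_one_pow]
  ring

/-- **`E_ℂ = (-1)ᵖ Q_k` read through `Θ`**: `E_ℂ(x, y) = (-1)ᵖ Q_k(Θx, Θy)` on `ℂ ⊗_ℚ Hᵏ(X, ℚ)`.
[cite: Lange2023AbelianVarietiesComplex, §5.4.2 (5.26)] -/
theorem IsNSForm.griffithsRatForm_baseChange (hη : IsNSForm Φ η) {g : ℕ} (e : Fin (2 * g) ≃ ι) {k r : ℕ}
    (hkr : k + r = g) (p : ℕ) (x y : ℂ ⊗[ℚ] rationalForms Φ k) :
    (hη.griffithsRatForm Φ e hkr p).baseChange ℂ x y =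
      (-1) ^ p * lefschetzIntersectionForm Φ η e hkr (complexification Φ k x) (complexification Φ k y) := by
  induction x using TensorProduct.induction_on generalizing y with
  | zero => rw [map_zero, LinearMap.zero_apply, map_zero, map_zero, LinearMap.zero_apply, mul_zero]
  | tmul a γ =>
    induction y using TensorProduct.induction_on with
    | zero => rw [map_zero, map_zero, map_zero, mul_zero]
    | tmul c δ =>
      rw [LinearMap.BilinForm.baseChange_tmul, complexification_tmul, complexification_tmul]
      simp only [map_smul, LinearMap.smul_apply, smul_eq_mul]
      rw [Rat.smul_def, hη.coe_griffithsRatForm Φ e hkr]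
      ring
    | add y y' hy hy' => rw [map_add, hy, hy', map_add, map_add, mul_add]
  | add x x' hx hx' =>
    rw [map_add, LinearMap.add_apply, hx, hx', map_add, map_add, LinearMap.add_apply, mul_add]

variable [FiniteDimensional ℂ E]

/-- **`Q_k` vanishes on pairs of forms of Hodge types `≥ c` when `2c ≥ k + 1`** (the type of
`ω^{n-k} ∧ φ ∧ ψ` exceeds `(n, n)` in the holomorphic degree): the type count behind "`F^p` is isotropic
for `E`". [cite: Lange2023AbelianVarietiesComplex, §5.4.2 Thm. 5.4.6 (Step I)] [cite: VoisinHodgeI2002, §7.1.2 (PDF p. 134)] -/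
theorem lefschetzIntersectionForm_eq_zero_of_mem_upper (h11 : ∀ u v : E, η ![I • u, I • v] = η ![u, v])
    {g : ℕ} (e : Fin (2 * g) ≃ ι) {k r : ℕ} (hkr : k + r = g) {c : ℤ} (hc : (k : ℤ) + 1 ≤ c + c)
    {φ ψ : E [⋀^Fin k]→L[ℝ] ℂ}
    (hφ : φ ∈ ⨆ (pq : ↥(antidiagonal k)) (_ : c ≤ (pq.1.1 : ℤ)), typeSubmodule E k pq.1.1 pq.1.2)
    (hψ : ψ ∈ ⨆ (pq : ↥(antidiagonal k)) (_ : c ≤ (pq.1.1 : ℤ)), typeSubmodule E k pq.1.1 pq.1.2) :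
    lefschetzIntersectionForm Φ η e hkr φ ψ = 0 := by
  classical
  have hφ' := (mem_biSup_typeSubmodule_iff (fun pq : ℕ × ℕ ↦ c ≤ (pq.1 : ℤ)) φ).1 hφ
  have hψ' := (mem_biSup_typeSubmodule_iff (fun pq : ℕ × ℕ ↦ c ≤ (pq.1 : ℤ)) ψ).1 hψ
  rw [← sum_antidiagonal_typeProjAt φ, ← sum_antidiagonal_typeProjAt ψ,
    map_sum (lefschetzIntersectionForm Φ η e hkr), LinearMap.sum_apply]
  refine Finset.sum_eq_zero fun pq hpq ↦ ?_
  rw [map_sum]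
  refine Finset.sum_eq_zero fun pq' hpq' ↦ ?_
  have h1 := mem_antidiagonal.1 hpq
  have h2 := mem_antidiagonal.1 hpq'
  by_cases hc1 : c ≤ (pq.1 : ℤ)
  · by_cases hc2 : c ≤ (pq'.1 : ℤ)
    · exact lefschetzIntersectionForm_eq_zero_of_isOfTypeAt Φ η h11 e hkr (isOfTypeAt_typeProjAt h1 φ)
        (isOfTypeAt_typeProjAt h2 ψ) (by omega)
    · rw [hψ' pq' hpq' hc2, map_zero]
  · rw [hφ' pq hpq hc1, LinearMap.map_zero₂]

/-- **Thm. 5.4.6 Step I for the torus: `FᵖH^{2p-1}(X)` is isotropic for `E = (-1)ᵖ Q_{2p-1}`**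
(`E_ℂ(x, y) = 0` for `x, y ∈ Fᵖ`). [cite: Lange2023AbelianVarietiesComplex, §5.4.2 Thm. 5.4.6 (Step I)] -/
theorem IsNSForm.griffithsRatForm_baseChange_eq_zero (hη : IsNSForm Φ η) {g : ℕ} (e : Fin (2 * g) ≃ ι)
    {k r p : ℕ} (hkr : k + r = g) (hp : (p : ℤ) + p = k + 1) {x y : ℂ ⊗[ℚ] rationalForms Φ k}
    (hx : x ∈ (hodgeStructure Φ k).F p) (hy : y ∈ (hodgeStructure Φ k).F p) :
    (hη.griffithsRatForm Φ e hkr p).baseChange ℂ x y = 0 := by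
  rw [hη.griffithsRatForm_baseChange, lefschetzIntersectionForm_eq_zero_of_mem_upper Φ hη.type_one_one e hkr
    (c := (p : ℤ)) (by omega) ((mem_hodgeStructure_F_iff (Φ := Φ) (k := k) (p : ℤ)).1 hx)
    ((mem_hodgeStructure_F_iff (Φ := Φ) (k := k) (p : ℤ)).1 hy), mul_zero]

end RatForm

section Chart

variable {ι : Type*} [Fintype ι] {E : Type*} [NormedAddCommGroup E] [NormedSpace ℂ E]
  (Φ : (ι → ℝ) ≃L[ℝ] E)

omit [Fintype ι] in
/-- `\overline{(\overline{F^p})} = F^p` on forms, first half: the conjugate of a form in `\overline{FᵖHᵏ}`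
(types `(a, b)`, `a < p`) is a sum of types `(a', b')` with `a' ≥ p` (`k + 1 = 2p`).
[cite: Lange2023AbelianVarietiesComplex, §1.1.5 Thm. 1.1.21] -/
theorem conjForm_mem_upper_of_mem_lowerForms {k p : ℕ} (hkp : k + 1 = 2 * p) {ψ : E [⋀^Fin k]→L[ℝ] ℂ}
    (hψ : ψ ∈ lowerForms E k p) :
    conjForm ψ ∈ ⨆ (pq : ↥(antidiagonal k)) (_ : (p : ℤ) ≤ (pq.1.1 : ℤ)), typeSubmodule E k pq.1.1 pq.1.2 := by
  refine Submodule.iSup_induction (p := fun pq : ↥(antidiagonal k) ↦ ⨆ (_ : pq.1.1 < p),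
      typeSubmodule E k pq.1.1 pq.1.2)
    (motive := fun ψ ↦ conjForm ψ ∈ ⨆ (pq : ↥(antidiagonal k)) (_ : (p : ℤ) ≤ (pq.1.1 : ℤ)),
      typeSubmodule E k pq.1.1 pq.1.2)
    hψ (fun pq φ hφ ↦ ?_) (by rw [conj_zero]; exact zero_mem _)
    (fun φ φ' hφ hφ' ↦ by rw [conj_add]; exact add_mem hφ hφ')
  by_cases hlt : pq.1.1 < p
  · rw [iSup_pos hlt] at hφ
    have hab := mem_antidiagonal.1 pq.2
    exact le_iSup₂_of_le (f := fun (pq' : ↥(antidiagonal k)) (_ : (p : ℤ) ≤ (pq'.1.1 : ℤ)) ↦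
        typeSubmodule E k pq'.1.1 pq'.1.2)
      ⟨(pq.1.2, pq.1.1), mem_antidiagonal.2 (by omega)⟩ (by push_cast; omega) le_rfl
      (conjForm_mem_typeSubmodule hab hφ)
  · rw [iSup_neg hlt, Submodule.mem_bot] at hφ
    rw [hφ, conj_zero]
    exact zero_mem _

omit [Fintype ι] in
/-- Second half: the conjugate of a sum of types `(a, b)`, `a ≥ p`, lies in `\overline{FᵖHᵏ}` (`k + 1 = 2p`).
[cite: Lange2023AbelianVarietiesComplex, §1.1.5 Thm. 1.1.21] -/
theorem conjForm_mem_lowerForms_of_mem_upper {k p : ℕ} (hkp : k + 1 = 2 * p) {ψ : E [⋀^Fin k]→L[ℝ] ℂ}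
    (hψ : ψ ∈ ⨆ (pq : ↥(antidiagonal k)) (_ : (p : ℤ) ≤ (pq.1.1 : ℤ)), typeSubmodule E k pq.1.1 pq.1.2) :
    conjForm ψ ∈ lowerForms E k p := by
  refine Submodule.iSup_induction (p := fun pq : ↥(antidiagonal k) ↦ ⨆ (_ : (p : ℤ) ≤ (pq.1.1 : ℤ)),
      typeSubmodule E k pq.1.1 pq.1.2) (motive := fun ψ ↦ conjForm ψ ∈ lowerForms E k p)
    hψ (fun pq φ hφ ↦ ?_) (by rw [conj_zero]; exact zero_mem _)
    (fun φ φ' hφ hφ' ↦ by rw [conj_add]; exact add_mem hφ hφ')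
  by_cases hle : (p : ℤ) ≤ (pq.1.1 : ℤ)
  · rw [iSup_pos hle] at hφ
    have hab := mem_antidiagonal.1 pq.2
    exact typeSubmodule_le_lowerForms (by omega) (by omega) (conjForm_mem_typeSubmodule hab hφ)
  · rw [iSup_neg hle, Submodule.mem_bot] at hφ
    rw [hφ, conj_zero]
    exact zero_mem _

omit [Fintype ι] in
/-- **`ψ ∈ \overline{FᵖH^{2p-1}}` iff `ψ̄ ∈ FᵖH^{2p-1}`** (on forms). [cite: Lange2023AbelianVarietiesComplex, §5.4.2 (5.25)] -/
theorem conjForm_mem_upper_iff {k p : ℕ} (hkp : k + 1 = 2 * p) {ψ : E [⋀^Fin k]→L[ℝ] ℂ} :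
    conjForm ψ ∈ ⨆ (pq : ↥(antidiagonal k)) (_ : (p : ℤ) ≤ (pq.1.1 : ℤ)), typeSubmodule E k pq.1.1 pq.1.2 ↔
      ψ ∈ lowerForms E k p :=
  ⟨fun h ↦ by
    simpa only [Literature.LinearAlgebra.Alternating.conj_conj] using conjForm_mem_lowerForms_of_mem_upper hkp h,
    conjForm_mem_upper_of_mem_lowerForms hkp⟩

/-- **`Θ` carries `\overline{FᵖH^{2p-1}(X)} ⊂ ℂ ⊗ H^{2p-1}(X, ℚ)` onto `\overline{FᵖH^{2p-1}}` on forms**: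
`Θ x ∈ lowerForms` iff `x ∈ \overline{Fᵖ}` for the Hodge structure `hodgeStructure Φ k`.
[cite: Lange2023AbelianVarietiesComplex, §5.4.2 (5.25)] -/
theorem complexification_mem_lowerForms_iff {k p : ℕ} (hkp : k + 1 = 2 * p) {x : ℂ ⊗[ℚ] rationalForms Φ k} :
    complexification Φ k x ∈ lowerForms E k p ↔ x ∈ complexConj ((hodgeStructure Φ k).F p) := by
  rw [mem_complexConj, mem_hodgeStructure_F_iff, complexification_conj, conjForm_mem_upper_iff hkp]

/-- `Θ(\overline{Fᵖ}) = \overline{FᵖH^{2p-1}}` on forms, as an equality of submodules. [cite: Lange2023AbelianVarietiesComplex, §5.4.2 (5.25)] -/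
theorem map_complexification_complexConj_F {k p : ℕ} (hkp : k + 1 = 2 * p) :
    (complexConj ((hodgeStructure Φ k).F p)).map (complexification Φ k : _ →ₗ[ℂ] _) = lowerForms E k p := by
  ext y
  rw [Submodule.mem_map_equiv, ← complexification_mem_lowerForms_iff Φ hkp, LinearEquiv.apply_symm_apply]

variable [DecidableEq ι]

/-- **The tangent chart of `J_G^p(X)` into forms**: `ℂ^m → H^{2p-1}(X, ℂ)`, `m = dim FᵖH^{2p-1}`, the
composite of the Griffiths chart `v ↦ a - iJ_G a ∈ \overline{Fᵖ}` of the Hodge structure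
`H^{2p-1}(X, ℚ) = hodgeStructure Φ (2p-1)` with `Θ : ℂ ⊗ H^{2p-1}(X, ℚ) ≅ H^{2p-1}(X, ℂ)`; its source is the
universal cover of `J_G^p(X) = ComplexTorus (griffithsPeriod (hodgeStructure Φ (2p-1)) p hp b)`.
[cite: Lange2023AbelianVarietiesComplex, §5.4.2 Prop. 5.4.4 and (5.25)] -/
def griffithsFormsChart (k p : ℕ) (hp : (p : ℤ) + p = k + 1) :
    (Fin (finrank ℂ ((hodgeStructure Φ k).F p)) → ℂ) →ₗ[ℂ] (E [⋀^Fin k]→L[ℝ] ℂ) :=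
  (complexification Φ k : _ →ₗ[ℂ] _) ∘ₗ griffithsChart (hodgeStructure Φ k) p hp

omit [DecidableEq ι] in
/-- `griffithsFormsChart v = Θ (griffithsChart v)`. [cite: Lange2023AbelianVarietiesComplex, §5.4.2 (5.25)] -/
theorem griffithsFormsChart_apply {k p : ℕ} (hp : (p : ℤ) + p = k + 1)
    (v : Fin (finrank ℂ ((hodgeStructure Φ k).F p)) → ℂ) :
    griffithsFormsChart Φ k p hp v = complexification Φ k (griffithsChart (hodgeStructure Φ k) p hp v) :=
  rfl

omit [DecidableEq ι] in
/-- The forms chart is injective. [cite: Lange2023AbelianVarietiesComplex, §5.4.2 Prop. 5.4.4] -/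
theorem griffithsFormsChart_injective {k p : ℕ} (hp : (p : ℤ) + p = k + 1) :
    Function.Injective (griffithsFormsChart Φ k p hp) :=
  (complexification Φ k).injective.comp (griffithsChart_injective _ _ _)

omit [DecidableEq ι] in
/-- **The range of the forms chart is `\overline{FᵖH^{2p-1}}`** ("`H^{2p-1}(M,ℝ) ≅ \overline{F^pH^{2p-1}}`").
[cite: Lange2023AbelianVarietiesComplex, §5.4.2 Prop. 5.4.4 and (5.25)] -/
theorem range_griffithsFormsChart {k p : ℕ} (hp : (p : ℤ) + p = k + 1) :
    LinearMap.range (griffithsFormsChart Φ k p hp) = lowerForms E k p := by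
  rw [griffithsFormsChart, LinearMap.range_comp, range_griffithsChart, map_complexification_complexConj_F Φ (by omega)]

end Chart

section Transport

variable {ι : Type*} [Fintype ι] [DecidableEq ι] {E : Type*} [NormedAddCommGroup E] [NormedSpace ℂ E]
  (Φ : (ι → ℝ) ≃L[ℝ] E) {η : E [⋀^Fin 2]→L[ℝ] ℝ} {ι' : Type*} [Fintype ι']

set_option maxHeartbeats 800000 in
/-- **`H_G^p` on the chart: `H_G^p(σv, σv) = -4 E_ℝ(a, J_G a)`** for `σ = griffithsFormsChart`, `a` the real
class with complex coordinates `v` (`H_G^p(φ, φ) = 2iE_ℂ(φ, φ̄)`, `φ = a - iJ_G a`,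
`E_ℂ(φ, φ̄) = 2iE_ℝ(a, J_G a)`). [cite: Lange2023AbelianVarietiesComplex, §5.4.2 Thm. 5.4.6 (Step I, (5.26))] -/
theorem IsNSForm.griffithsForm_griffithsFormsChart_self (hη : IsNSForm Φ η) {g : ℕ} (e : Fin (2 * g) ≃ ι)
    {k r p : ℕ} (hkr : k + r = g) (hp : (p : ℤ) + p = k + 1) (b : Basis ι' ℚ (rationalForms Φ k))
    (v : Fin (finrank ℂ ((hodgeStructure Φ k).F p)) → ℂ) :
    griffithsForm Φ η e hkr p (griffithsFormsChart Φ k p hp v) (griffithsFormsChart Φ k p hp v) =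
      -(4 * (((hη.griffithsRatForm Φ e hkr p).baseChange ℝ
        ((b.baseChange ℝ).equivFun.symm ((griffithsPeriod (hodgeStructure Φ k) p hp b).symm v))
        (griffithsCx (hodgeStructure Φ k) p hp
          ((b.baseChange ℝ).equivFun.symm ((griffithsPeriod (hodgeStructure Φ k) p hp b).symm v))) : ℝ) : ℂ)) := by
  have hodd : Odd k := ⟨p - 1, by omega⟩
  have h2 := hη.griffithsRatForm_baseChange Φ e hkr p (griffithsChart (hodgeStructure Φ k) p hp v)
    (HodgeStructure.conj (griffithsChart (hodgeStructure Φ k) p hp v))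
  have h3 := baseChange_griffithsChart_conj (hodgeStructure Φ k) p hp b (hη.griffithsRatForm Φ e hkr p)
    (hη.griffithsRatForm_swap Φ e hkr p hodd) v
  rw [h2] at h3
  have hI : I * I = -1 := Complex.I_mul_I
  rw [griffithsForm_apply, griffithsFormsChart_apply, ← complexification_conj]
  linear_combination (2 * I) * h3 + (4 * (((hη.griffithsRatForm Φ e hkr p).baseChange ℝ
        ((b.baseChange ℝ).equivFun.symm ((griffithsPeriod (hodgeStructure Φ k) p hp b).symm v))
        (griffithsCx (hodgeStructure Φ k) p hp
          ((b.baseChange ℝ).equivFun.symm ((griffithsPeriod (hodgeStructure Φ k) p hp b).symm v))) : ℝ) : ℂ)) * hI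

set_option maxHeartbeats 800000 in
/-- **`H_G^p` IS the hermitian form of the NS class `N·E` of `J_G^p(X)`, on the diagonal**: for
`B = N · E_ℝ` in lattice coordinates and `ω_B` its translation-invariant `2`-form on `J_G^p(X)`,
`N · H_G^p(σv, σv) = 4 ω_B(iv, v)` (`= 4 N E_ℝ(J_G a, a)`).
[cite: Lange2023AbelianVarietiesComplex, §5.4.2 Thm. 5.4.6 (Step I, (5.26))] -/
theorem IsNSForm.griffithsForm_griffithsFormsChart_self_eq_twoForm (hη : IsNSForm Φ η) {g : ℕ}
    (e : Fin (2 * g) ≃ ι) {k r p : ℕ} (hkr : k + r = g) (hp : (p : ℤ) + p = k + 1)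
    (b : Basis ι' ℚ (rationalForms Φ k)) {B : LinearMap.BilinForm ℝ (ι' → ℝ)} {hB : ∀ x, B x x = 0} {N : ℕ}
    (hBapp : ∀ x y, B x y = (N : ℝ) * (hη.griffithsRatForm Φ e hkr p).baseChange ℝ
      ((b.baseChange ℝ).equivFun.symm x) ((b.baseChange ℝ).equivFun.symm y))
    (v : Fin (finrank ℂ ((hodgeStructure Φ k).F p)) → ℂ) :
    ((N : ℝ) : ℂ) * griffithsForm Φ η e hkr p (griffithsFormsChart Φ k p hp v) (griffithsFormsChart Φ k p hp v) =
      ((4 * twoForm (griffithsPeriod (hodgeStructure Φ k) p hp b) B hB ![I • v, v] : ℝ) : ℂ) := by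
  have hodd : Odd k := ⟨p - 1, by omega⟩
  rw [hη.griffithsForm_griffithsFormsChart_self Φ e hkr hp b v,
    twoForm_griffithsPeriod_I_smul_self (hodgeStructure Φ k) p hp b (hη.griffithsRatForm Φ e hkr p) B hB
      (c := (N : ℝ)) hBapp v,
    baseChange_real_swap (hη.griffithsRatForm Φ e hkr p) (hη.griffithsRatForm_swap Φ e hkr p hodd)
      ((b.baseChange ℝ).equivFun.symm ((griffithsPeriod (hodgeStructure Φ k) p hp b).symm v))
      (griffithsCx (hodgeStructure Φ k) p hp
        ((b.baseChange ℝ).equivFun.symm ((griffithsPeriod (hodgeStructure Φ k) p hp b).symm v)))]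
  push_cast
  ring

/-- **Negativity on the chart**: `ω_B(iv, v) < 0` iff `Re H_G^p(σv, σv) < 0` (`N ≥ 1`).
[cite: Lange2023AbelianVarietiesComplex, §5.4.2 Thm. 5.4.6] -/
theorem IsNSForm.twoForm_I_smul_self_neg_iff (hη : IsNSForm Φ η) {g : ℕ} (e : Fin (2 * g) ≃ ι)
    {k r p : ℕ} (hkr : k + r = g) (hp : (p : ℤ) + p = k + 1) (b : Basis ι' ℚ (rationalForms Φ k))
    {B : LinearMap.BilinForm ℝ (ι' → ℝ)} {hB : ∀ x, B x x = 0} {N : ℕ} (hN : 0 < N)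
    (hBapp : ∀ x y, B x y = (N : ℝ) * (hη.griffithsRatForm Φ e hkr p).baseChange ℝ
      ((b.baseChange ℝ).equivFun.symm x) ((b.baseChange ℝ).equivFun.symm y))
    (v : Fin (finrank ℂ ((hodgeStructure Φ k).F p)) → ℂ) :
    twoForm (griffithsPeriod (hodgeStructure Φ k) p hp b) B hB ![I • v, v] < 0 ↔
      (griffithsForm Φ η e hkr p (griffithsFormsChart Φ k p hp v) (griffithsFormsChart Φ k p hp v)).re < 0 := by
  have h := congrArg Complex.re (hη.griffithsForm_griffithsFormsChart_self_eq_twoForm Φ e hkr hp b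
    (B := B) (hB := hB) (N := N) hBapp v)
  rw [Complex.re_ofReal_mul, Complex.ofReal_re] at h
  have hN' : (0 : ℝ) < N := by exact_mod_cast hN
  constructor
  · intro hω
    have hlt : (N : ℝ) * (griffithsForm Φ η e hkr p (griffithsFormsChart Φ k p hp v)
        (griffithsFormsChart Φ k p hp v)).re < N * 0 := by rw [h, mul_zero]; linarith
    exact lt_of_mul_lt_mul_left hlt hN'.le
  · intro hre
    have := mul_neg_of_pos_of_neg hN' hre
    linarith

variable [FiniteDimensional ℂ E]

set_option maxHeartbeats 800000 in
/-- **`E_ℝ` is the imaginary part of `H_G^p` on the chart**: `N · Im H_G^p(σv, σw) = -4 ω_B(v, w)` for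
`B = N · E_ℝ` (`H_G^p(φ, ψ) = 2iE(φ, ψ̄)` read on `φ = a - iJ_G a`, `ψ = c - iJ_G c`, with
`E_ℝ(J_G a, J_G c) = E_ℝ(a, c)`). [cite: Lange2023AbelianVarietiesComplex, §5.4.2 Thm. 5.4.6 (Step I, (5.26))] -/
theorem IsNSForm.im_griffithsForm_griffithsFormsChart (hη : IsNSForm Φ η) {g : ℕ} (e : Fin (2 * g) ≃ ι)
    {k r p : ℕ} (hkr : k + r = g) (hp : (p : ℤ) + p = k + 1) (b : Basis ι' ℚ (rationalForms Φ k))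
    {B : LinearMap.BilinForm ℝ (ι' → ℝ)} {hB : ∀ x, B x x = 0} {N : ℕ}
    (hBapp : ∀ x y, B x y = (N : ℝ) * (hη.griffithsRatForm Φ e hkr p).baseChange ℝ
      ((b.baseChange ℝ).equivFun.symm x) ((b.baseChange ℝ).equivFun.symm y))
    (v w : Fin (finrank ℂ ((hodgeStructure Φ k).F p)) → ℂ) :
    (N : ℝ) * (griffithsForm Φ η e hkr p (griffithsFormsChart Φ k p hp v) (griffithsFormsChart Φ k p hp w)).im =
      -(4 * twoForm (griffithsPeriod (hodgeStructure Φ k) p hp b) B hB ![v, w]) := by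
  have hodd : Odd k := ⟨p - 1, by omega⟩
  have h2 := hη.griffithsRatForm_baseChange Φ e hkr p (griffithsChart (hodgeStructure Φ k) p hp w)
    (HodgeStructure.conj (griffithsChart (hodgeStructure Φ k) p hp v))
  have h5 := im_two_I_mul_baseChange_griffithsChart_conj (hodgeStructure Φ k) p hp b (hη.griffithsRatForm Φ e hkr p)
    (fun x hx y hy ↦ hη.griffithsRatForm_baseChange_eq_zero Φ e hkr hp hx hy) v w
  have h6 : griffithsForm Φ η e hkr p (griffithsFormsChart Φ k p hp v) (griffithsFormsChart Φ k p hp w) =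
      2 * I * ((-1) ^ p * lefschetzIntersectionForm Φ η e hkr
        (complexification Φ k (griffithsChart (hodgeStructure Φ k) p hp w))
        (complexification Φ k (HodgeStructure.conj (griffithsChart (hodgeStructure Φ k) p hp v)))) := by
    rw [griffithsForm_apply, griffithsFormsChart_apply, griffithsFormsChart_apply, ← complexification_conj]
    ring
  have hω := twoForm_griffithsPeriod_apply (hodgeStructure Φ k) p hp b (hη.griffithsRatForm Φ e hkr p) B hB
    (c := (N : ℝ)) hBapp v w
  have hsw := baseChange_real_swap (hη.griffithsRatForm Φ e hkr p) (hη.griffithsRatForm_swap Φ e hkr p hodd)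
    ((b.baseChange ℝ).equivFun.symm ((griffithsPeriod (hodgeStructure Φ k) p hp b).symm v))
    ((b.baseChange ℝ).equivFun.symm ((griffithsPeriod (hodgeStructure Φ k) p hp b).symm w))
  rw [h6, ← h2, h5, hω]
  linear_combination (4 * (N : ℝ)) * hsw

end Transport

section Main

variable {ι : Type*} [Fintype ι] [DecidableEq ι] {E : Type*} [NormedAddCommGroup E] [NormedSpace ℂ E]
  (Φ : (ι → ℝ) ≃L[ℝ] E) {η : E [⋀^Fin 2]→L[ℝ] ℝ} [FiniteDimensional ℂ E]
  {ι' : Type*} [Fintype ι']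

set_option maxHeartbeats 800000 in
/-- **THEOREM 5.4.6 (Lange 2023), the index: `index ω_{N·E} = i(p)` on `J_G^p(X)`.** For a polarised complex
torus `X = E/Φ(ℤ^ι)` of dimension `g` (Riemann form `η`), `k = 2p - 1 ≤ g`, a lattice basis `b` of
`H^{2p-1}(X, ℚ)` and the NS form `ω_B` of `B = N·E_ℝ`, `E = (-1)ᵖQ_k`, on the Griffiths intermediate Jacobian
`J_G^p(X) = ComplexTorus (griffithsPeriod (hodgeStructure Φ k) p hp b)`, the index of the hermitian form of
`ω_B` (the tree's `hermIndex`: the maximal dimension of a negative definite complex subspace) equals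
`i(p) = Σ_t Σ_s (h^{p-2-2t,p+1-2s+2t} - h^{p-3-2t,p-2s+2t})` — by Step V (`\overline{Fᵖ} = (pos) ⊕ (neg)`,
Sylvester) transported along the forms chart `σ` (`N·H_G^p(σv,σv) = 4ω_B(iv,v)`).
[cite: Lange2023AbelianVarietiesComplex, §5.4.2 Thm. 5.4.6] -/
theorem IsRiemannForm.hermIndex_twoForm_griffithsPeriod (hη : IsRiemannForm Φ η) {g : ℕ} (e : Fin (2 * g) ≃ ι)
    {k r p : ℕ} (hkr : k + r = g) (hp : (p : ℤ) + p = k + 1) (b : Basis ι' ℚ (rationalForms Φ k))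
    {B : LinearMap.BilinForm ℝ (ι' → ℝ)} {hB : ∀ x, B x x = 0} {N : ℕ} (hN : 0 < N)
    (hBapp : ∀ x y, B x y = (N : ℝ) * ((hη.isNSForm Φ).griffithsRatForm Φ e hkr p).baseChange ℝ
      ((b.baseChange ℝ).equivFun.symm x) ((b.baseChange ℝ).equivFun.symm y)) :
    hermIndex (twoForm (griffithsPeriod (hodgeStructure Φ k) p hp b) B hB) = griffithsIndex g p := by
  have hkp : k + 1 = 2 * p := by omega
  have hg : finrank ℂ E = g := finrank_eq_of_finTwoMulEquiv Φ e
  haveI := finiteDimensional_alt_of_le (E := E) (k := k) (by omega)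
  have h11 := (hη.isNSForm Φ).type_one_one
  set σ := griffithsFormsChart Φ k p hp with hσ
  have hσinj : Function.Injective σ := griffithsFormsChart_injective Φ hp
  have hσrange : LinearMap.range σ = lowerForms E k p := range_griffithsFormsChart Φ hp
  have hsign : ∀ v, twoForm (griffithsPeriod (hodgeStructure Φ k) p hp b) B hB ![I • v, v] < 0 ↔
      (griffithsForm Φ η e hkr p (σ v) (σ v)).re < 0 :=
    (hη.isNSForm Φ).twoForm_I_smul_self_neg_iff Φ e hkr hp b (B := B) (hB := hB) (N := N) hN hBapp
  rw [← hg, ← finrank_griffithsNeg_eq_griffithsIndex (hη.exists_apply_ne_zero Φ) h11 hkp (by omega),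
    hermIndex_def]
  refine IsGreatest.csSup_eq ⟨⟨(griffithsNeg η k p).comap σ, ?_, fun v hv hv0 ↦ ?_⟩, ?_⟩
  · have hle : griffithsNeg η k p ≤ LinearMap.range σ := hσrange ▸ griffithsNeg_le_lowerForms h11 hkp
    rw [(Submodule.equivMapOfInjective σ hσinj _).finrank_eq, Submodule.map_comap_eq, inf_eq_right.2 hle]
  · exact (hsign v).2 (hη.isNegDefOn_griffithsForm_griffithsNeg Φ e hkr hkp (σ v) hv
      fun h ↦ hv0 (hσinj (by rw [h, map_zero])))
  · rintro n ⟨W, rfl, hW⟩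
    have hneg : IsNegDefOn (griffithsForm Φ η e hkr p) (W.map σ) := by
      intro x hx hx0
      obtain ⟨v, hv, rfl⟩ := Submodule.mem_map.1 hx
      exact (hsign v).1 (hW v hv fun h ↦ hx0 (by rw [h, map_zero]))
    calc finrank ℂ W = finrank ℂ (W.map σ) := (Submodule.equivMapOfInjective σ hσinj W).finrank_eq
      _ ≤ finrank ℂ (griffithsNeg η k p) :=
          hη.finrank_le_finrank_griffithsNeg Φ e hkr hkp (hσrange ▸ LinearMap.map_le_range) hneg

set_option maxHeartbeats 800000 in
/-- **THEOREM 5.4.6, non-degeneracy: the NS form `ω_{N·E}` of `J_G^p(X)` is non-degenerate** (so the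
line bundle with first Chern class `N·H_G^p` is non-degenerate of index `i(p)`): `H_G^p` is non-degenerate
on `\overline{Fᵖ}` (Step V) and `E_ℝ = -¼ N⁻¹ · Im H_G^p` on the chart.
[cite: Lange2023AbelianVarietiesComplex, §5.4.2 Thm. 5.4.6] -/
theorem IsRiemannForm.twoForm_griffithsPeriod_nondegenerate (hη : IsRiemannForm Φ η) {g : ℕ}
    (e : Fin (2 * g) ≃ ι) {k r p : ℕ} (hkr : k + r = g) (hp : (p : ℤ) + p = k + 1)
    (b : Basis ι' ℚ (rationalForms Φ k)) {B : LinearMap.BilinForm ℝ (ι' → ℝ)} {hB : ∀ x, B x x = 0} {N : ℕ}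
    (hN : 0 < N)
    (hBapp : ∀ x y, B x y = (N : ℝ) * ((hη.isNSForm Φ).griffithsRatForm Φ e hkr p).baseChange ℝ
      ((b.baseChange ℝ).equivFun.symm x) ((b.baseChange ℝ).equivFun.symm y))
    (v : Fin (finrank ℂ ((hodgeStructure Φ k).F p)) → ℂ) (hv : v ≠ 0) :
    ∃ w, twoForm (griffithsPeriod (hodgeStructure Φ k) p hp b) B hB ![v, w] ≠ 0 := by
  have hkp : k + 1 = 2 * p := by omega
  set σ := griffithsFormsChart Φ k p hp with hσ
  have hσinj : Function.Injective σ := griffithsFormsChart_injective Φ hp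
  have hσrange : LinearMap.range σ = lowerForms E k p := range_griffithsFormsChart Φ hp
  have hσv : σ v ∈ lowerForms E k p := hσrange ▸ LinearMap.mem_range_self σ v
  have hσv0 : σ v ≠ 0 := fun h ↦ hv (hσinj (by rw [h, map_zero]))
  obtain ⟨y, hy, hne⟩ := hη.exists_griffithsForm_ne_zero Φ e hkr hkp hσv hσv0
  obtain ⟨w, rfl⟩ : y ∈ LinearMap.range σ := hσrange ▸ hy
  have him := (hη.isNSForm Φ).im_griffithsForm_griffithsFormsChart Φ e hkr hp b (B := B) (hB := hB) (N := N) hBapp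
  have hN' : (N : ℝ) ≠ 0 := by exact_mod_cast hN.ne'
  by_cases h0 : (griffithsForm Φ η e hkr p (σ v) (σ w)).im = 0
  · refine ⟨I • w, fun hω ↦ ?_⟩
    have hre : (griffithsForm Φ η e hkr p (σ v) (σ w)).re ≠ 0 := fun hre ↦
      hne (Complex.ext (by rw [hre, Complex.zero_re]) (by rw [h0, Complex.zero_im]))
    have h := him v (I • w)
    rw [hω, mul_zero, neg_zero, map_smul, map_smul, smul_eq_mul, Complex.mul_im, Complex.I_re,
      Complex.I_im, zero_mul, one_mul, zero_add] at h
    exact hre ((mul_eq_zero.1 h).resolve_left hN')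
  · refine ⟨w, fun hω ↦ ?_⟩
    have h := him v w
    rw [hω, mul_zero, neg_zero] at h
    exact h0 ((mul_eq_zero.1 h).resolve_left hN')

variable [DecidableEq ι']

/-- **THEOREM 5.4.6 (Lange 2023 / Griffiths) for a polarised complex torus, assembled.** `X = E/Φ(ℤ^ι)` a
polarised complex torus of dimension `g` with Riemann form `η`, `1 ≤ p`, `k = 2p - 1 ≤ g` (i.e.
`p ≤ (g+1)/2`), `b` a basis of `H^{2p-1}(X, ℚ)`: on the Griffiths intermediate Jacobian
`J_G^p(X) = ComplexTorus (griffithsPeriod (hodgeStructure Φ (2p-1)) p hp b)` (a complex torus of dimension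
`dim FᵖH^{2p-1}`, Prop. 5.4.4 / Q261) the alternating form `N·E`, `E = (-1)ᵖQ_{2p-1}` of (5.26) (`N ≥ 1`
clearing denominators on `b`), read on `Λ ⊗ ℝ`, defines a translation-invariant `2`-form `ω` which
(i) lies in `NS(J_G^p(X))` (type `(1,1)` and integral: the first Chern class of a line bundle, Step I),
(ii) is non-degenerate, and (iii) has index `i(p) = griffithsIndex g p` (Steps II–V). Positivity fails for
`p ≥ 2` whenever `i(p) > 0` (e.g. `g = 3`, `p = 2`: `i = 4`, Prop. 5.4.9), so `J_G^p(X)` is a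
non-degenerate complex torus of index `i(p)` but in general not an abelian variety for this form.
[cite: Lange2023AbelianVarietiesComplex, §5.4.2 Thm. 5.4.6] [cite: Griffiths1968PeriodsII, §2] -/
theorem IsRiemannForm.griffiths_intermediateJacobian_index (hη : IsRiemannForm Φ η) {g : ℕ}
    (e : Fin (2 * g) ≃ ι) {k r p : ℕ} (hkr : k + r = g) (hp : (p : ℤ) + p = k + 1)
    (b : Basis ι' ℚ (rationalForms Φ k)) :
    ∃ (B : LinearMap.BilinForm ℝ (ι' → ℝ)) (hB : ∀ x, B x x = 0) (N : ℕ), 0 < N ∧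
      (∀ x y, B x y = (N : ℝ) * ((hη.isNSForm Φ).griffithsRatForm Φ e hkr p).baseChange ℝ
        ((b.baseChange ℝ).equivFun.symm x) ((b.baseChange ℝ).equivFun.symm y)) ∧
      IsNSForm (griffithsPeriod (hodgeStructure Φ k) p hp b)
        (twoForm (griffithsPeriod (hodgeStructure Φ k) p hp b) B hB) ∧
      (∀ v, v ≠ 0 → ∃ w, twoForm (griffithsPeriod (hodgeStructure Φ k) p hp b) B hB ![v, w] ≠ 0) ∧
      hermIndex (twoForm (griffithsPeriod (hodgeStructure Φ k) p hp b) B hB) = griffithsIndex g p := by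
  have hodd : Odd k := ⟨p - 1, by omega⟩
  obtain ⟨B, hB, N, hN, hBapp, hNS⟩ := exists_isNSForm_griffithsPeriod_of_isotropic (hodgeStructure Φ k) p hp b
    ((hη.isNSForm Φ).griffithsRatForm Φ e hkr p) ((hη.isNSForm Φ).griffithsRatForm_swap Φ e hkr p hodd)
    (fun x hx y hy ↦ (hη.isNSForm Φ).griffithsRatForm_baseChange_eq_zero Φ e hkr hp hx hy)
  exact ⟨B, hB, N, hN, hBapp, hNS,
    fun v hv ↦ hη.twoForm_griffithsPeriod_nondegenerate Φ e hkr hp b (B := B) (hB := hB) (N := N) hN hBapp v hv,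
    hη.hermIndex_twoForm_griffithsPeriod Φ e hkr hp b (B := B) (hB := hB) (N := N) hN hBapp⟩

omit [DecidableEq ι] [FiniteDimensional ℂ E] [DecidableEq ι'] in
/-- **The dimension of `J_G^p(X)`**: `2 · dim J_G^p(X) = 2 · dim FᵖH^{2p-1}(X) = b_{2p-1}(X) = C(2g, 2p-1)`
(Lange: `dim J_G^p = Σ_{r=p}^{2p-1} h^{r,2p-1-r}`, half the Betti number by Hodge symmetry).
[cite: Lange2023AbelianVarietiesComplex, §5.4.2 Thm. 5.4.6 and Prop. 5.4.4] -/
theorem two_mul_finrank_hodgeStructure_F {g : ℕ} (e : Fin (2 * g) ≃ ι) {k p : ℕ} (hp : (p : ℤ) + p = k + 1) :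
    2 * finrank ℂ ((hodgeStructure Φ k).F p) = (2 * g).choose k := by
  rw [two_mul_finrank_F (hodgeStructure Φ k) p hp, finrank_rationalForms_eq_choose, ← Fintype.card_congr e,
    Fintype.card_fin]

omit [DecidableEq ι] [FiniteDimensional ℂ E] [DecidableEq ι'] in
/-- **Proposition 5.4.9 (numerics): for an abelian threefold and `p = 2`, `J_G^2(X)` has dimension `10` and the
form has index `4`** (`dim = h^{2,1} + h^{3,0} = 9 + 1`, `i(2) = h^{0,3} + h^{0,1} = 1 + 3`).
[cite: Lange2023AbelianVarietiesComplex, §5.4.2 Prop. 5.4.9] -/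
theorem finrank_hodgeStructure_F_threefold (e : Fin (2 * 3) ≃ ι) (hp : ((2 : ℕ) : ℤ) + (2 : ℕ) = (3 : ℕ) + 1) :
    finrank ℂ ((hodgeStructure Φ 3).F (2 : ℕ)) = 10 ∧ griffithsIndex 3 2 = 4 := by
  refine ⟨?_, griffithsIndex_three_two⟩
  have h := two_mul_finrank_hodgeStructure_F Φ e hp
  have h20 : (2 * 3).choose 3 = 20 := by decide
  omega

end Main

end ComplexTorus

end Literature.Geometry.Kaehler
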